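import Summits.NavierStokesRegularity.NavierStokesRegularity.Theses.SymmetryModuliCount
import Literature.Analysis.FluidPDE.KNSSRemark61
import Literature.Analysis.FluidPDE.OseenKernelLineIntegrals
import Literature.Analysis.UnboundedOperators.HeatKernelFourier
import Literature.Analysis.UnboundedOperators.HeatExtensionDecay
import Literature.Analysis.FluidPDE.TypeIAncientMild
import Literature.Analysis.FluidPDE.ChaeWolfRemovingDSSBounds
import Literature.Analysis.FluidPDE.SwirlTransportProofs

/-!
# Disproof of `SymmetricLiouville` — findings

Standing adversary file for crux `stmt-NavierStokesRegularity-4053`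
(`Summit.NavierStokesRegularity.NavierStokesRegularity.Theses.SymmetryModuliCount.SymmetricLiouville`,
route `SymmetryModuliCount`, rank 3: "continuous symmetry is free" — a smooth, divergence-free,
KNSS-mild ancient field with Type-I time decay `‖u(t,x)‖ ≤ C/√(−t)` which is annihilated by the
generator `L_ξ` of a nonzero `ξ = (a, σ, A) ∈ sim(3)` vanishes identically).

## Landed under `Theorems/SymmetricLiouville/Negative/` (importable, kernel-checked, gate-accepted)

* `…Negative.AncientLoadBearing` (p73328): `shearWave`, `shearWave_mild`, `heatExtension_shear`,
  `SymmetricLiouvilleOnWindow`, `symmetricLiouville_false_on_window`.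
* `…Negative.FinerCuts` (p73829): `const_mild`, `isDivFree_fun_const`,
  `translation_symm_of_spatially_const`, `SymmetricLiouvilleTypeINearZeroBoundedPast`,
  `symmetricLiouville_false_typeI_near_zero_bounded_past`, `fade`, `fadedConst`,
  `SymmetricLiouvilleMildOnWindow`, `symmetricLiouville_false_mild_on_window`.
* `…Negative.LoadBearing` (p74252, accepted): `symmetricLiouville_iff`, the named mutants
  `SymmetricLiouvilleWithoutTypeI/WithoutMild/Bounded` and their refutations, `parasiticField`.
* cycle 2 (gen-2 seat; all ACCEPTED): `…Negative.NonlinearLoadBearing` (p77400; §§(d),(e):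
  bridge to `IsTypeIAncientMild`, linear Liouville / Duhamel-carries-everything, un-witnessability of
  the symmetry clause, the two harmless non-skew generators), `…Negative.SmallConstantGap` (p77402; the GAP
  THEOREM `exists_eps_small_vanishes`: `sup √(−t)‖u‖ ≤ ε₀ ⇒ u = 0`, so the crux and `X` hold for
  `C ≤ ε₀`), `…Negative.ScrewClause` (p77405; §(f): the screw clause integrates — periodicity along the axis,
  `IsAxisymmetric` from the infinitesimal clause).
* cycle 3 (gen-3 seat; proposed `--supports`): `…Negative.StubKinematics` and `…Negative.StubGauge`
  (§(g): load-bearing analysis of the six registered stubs of the picked line `blowdown-kills-pitch`).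

## Findings (index; details in the docstrings below)

* `InClass`, `IsSkew`, `HasSymmetry`, `symmetricLiouville_iff` — the crux unbundled
  (definitional `Iff.rfl` repackaging, so every lemma below is literally about the route decl).
* (0) SANITY: `inClass_zero` (`0 ∈ 𝒜_C` for `C ≥ 0`: hypotheses satisfiable, not vacuous),
  `symmetricLiouville_of_nonpos` (trivial regime `C ≤ 0`), and the position of the crux in the
  route: `symmetricLiouville_of_typeIAncientLiouville` (`X →` crux: the crux is a weakening of the
  target, so a kill of the crux kills `X` and the route), `typeIAncientLiouville_iff_forced_and_symmetric`
  (`X ↔ ForcedSymmetry ∧ SymmetricLiouville`).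
* (a) LOAD-BEARING HYPOTHESES, as theorems:
  - `symmetricLiouville_false_without_typeI` — drop `HasTypeITimeDecay`: FALSE (the constant field
    `u ≡ e₀` is smooth, div-free, KNSS-mild — `e^{σΔ}c = c` and `∫ K(σ, x−y)[c,c] dy = 0` by oddness of
    the in-tree Oseen kernel — and translation-invariant). Any proof must use the decay.
  - `symmetricLiouville_false_without_mild` — drop the Oseen integral equation (the KNSS gauge):
    FALSE (the parasitic field `u(t,x) = (1−t)⁻¹ • e₀` is smooth, div-free, Type-I with `C = 1`,
    translation-invariant, nonzero). Any proof must use the gauge; in particular the statement is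
    false in the duality-form mild classes that do not see spatial constants.
  - `symmetricLiouville_false_with_bounded` — replace Type-I decay by mere boundedness: FALSE by the
    constant field again (so a bounded-ancient version must conclude "u is constant", KNSS Rem. 6.1).
  - finer cuts: `symmetricLiouville_false_typeI_near_zero_bounded_past` (Type-I only on `(−1,0)` +
    bounded past: FALSE, constant field — the DECAY at `−∞` is what is used) and
    `symmetricLiouville_false_mild_on_window` (Oseen equation only between times of a final window
    `(−T,0)`, all else ancient: FALSE for every `T`, faded constant `φ_T(t)e₀` with
    `Real.smoothTransition` — the gauge must reach back to `−∞`).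
  - (a′) `symmetricLiouville_false_on_window` — weaken "ancient" to ANY finite backward window
    `(−T, 0)` (all hypotheses, the symmetry and the conclusion restricted to it): FALSE for every
    `T > 0`, witnessed by the viscous shear wave `e^{−4π²t} sin(2π y₀) e₁` (exact NS solution, KNSS-mild
    between any two times — `shearWave_mild` — Type-I on the window with `C = e^{4π²T}√T`, translation
    invariant, nonzero; it escapes the crux only by growing like `e^{4π²|t|}` as `t → −∞`). Any proof
    must use the behaviour as `t → −∞`, not just the equation + the rate near `t = 0`;
    `symmetricLiouville_of_forall_window` records that the window family is a strengthening.
* (b) BARRIER REDUCTIONS (the crux contains two statements that are open in print):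
  `HelicalTypeILiouville` (screw motions of nonzero pitch; only the STEADY helical Liouville theorem
  is in print — but see its docstring: very likely closable by blow-down) and
  `RotatedSelfSimilarLiouville` (σ = 1, A ≠ 0 skew, BOUNDED profile), with
  `symmetricLiouville_implies_helical`, `symmetricLiouville_implies_rss` (specialisations), and the
  residual open core `RotatedSelfSimilarLiouvilleDecaying` (= Pineau–Vicol Conj. 1.1 / Tsai 2018
  Conj. 8.9 in the gauge class, every `α ≠ 0`) with `symmetricLiouville_implies_rss_decaying`.
* (d) CYCLE 2 — THE NONLINEARITY IS LOAD-BEARING; THE SMALL-`C` REGIME IS EMPTY; THE SYMMETRY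
  CLAUSE IS UN-WITNESSABLE: `inClass_iff_isTypeIAncientMild` (the class IS the tree's
  `IsTypeIAncientMild`, definitional; so `InClass.timeShift`, `InClass.vanishes_of_slice_const` =
  KNSS Rem. 6.1 come for free); `vanishes_of_heatMild_typeI` (heat-propagated + Type-I ⇒ `0`: the
  LINEARISED crux is trivially true, with no symmetry at all), `InClass.vanishes_of_duhamel_zero` (an
  element of `𝒜_C` with vanishing Oseen–Duhamel term is `0` — kills every explicit family with
  null/gradient nonlinearity: constants, shear/parallel flows, Beltrami modes),
  `InClass.norm_le_div_sqrt_add_norm_duhamel` (`‖u(t,x)‖ ≤ C/√(−s) + ‖∫_s^t∫K[u,u]‖`: the Duhamel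
  integral from `−∞` must carry ALL of `u`); the GAP THEOREM `exists_eps_small_vanishes` /
  `exists_eps_vanishes_of_le` (absolute `ε₀ > 0`: `sup √(−t)‖u‖ ≤ ε₀ ⇒ u ≡ 0`, kernel-checked from
  Koch–Tataru (14) via the tree's Chae–Wolf Step-1 machinery — so the crux AND `X` hold for
  `C ≤ ε₀`, and every counterexample has scale-invariant size `> ε₀`);
  `exists_witness_of_not_symmetricLiouville` / `not_typeIAncientLiouville_of_not_symmetricLiouville`
  (any kill of the crux, or of ANY mutant keeping the four class hypotheses, exhibits `𝒜_C ∖ {0} ≠ ∅`,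
  i.e. a Type-I ancient solution = a Type-I singularity, and kills `X`: mutations of the symmetry
  clause cannot be witnessed by examples — only the class hypotheses can, §(a)).
* (e) CYCLE 2 — `IsSkew` SHIELDS NOTHING: `vanishes_of_hasSymmetry_id` (`ξ = (0,0,1)`, `(x·∇)u = u`:
  killed by boundedness of a slice, Euler's theorem `eq_zero_of_fderiv_self_of_bounded`) and
  `vanishes_of_hasSymmetry_antiscaling` (`ξ = (0,σ,−σ·1)`: `u = U(x)/(−t)`, killed by the RATE at
  `t → 0⁻`). Dropping `IsSkew` does not open a refutation.
* (f) CYCLE 2 — THE SCREW CLAUSE INTEGRATES (stub-audit item (iii) made formal, no NS content):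
  `screw_equivariant` (`Du(y)[h e_z + Jy] = Ju(y)` for all `y` ⇒ `u(R_θx + θh e_z) = R_θu(x)`; proof:
  `w = u∘γ − R_θu(x)` solves `w' = Jw`, `w(0) = 0`, `J` skew ⇒ `‖w‖²` constant), hence
  `periodic_of_screw_clause` (`u(x + 2πh e_z) = u(x)`), `isAxisymmetric_of_clause` (`h = 0`: the
  infinitesimal clause IS the tree's `IsAxisymmetric`), and on the class
  `InClass.periodic_of_hasSymmetry_screw`, `InClass.isAxisymmetric_of_hasSymmetry_rot`,
  `isSkew_rotGenL`. So the stubs `HelicalIsPeriodic` / `periodic_of_screw` are TRUE as audited and the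
  axis stubs' `IsAxisymmetric` hypotheses are faithful to the crux.
* (g) CYCLE 3 — TARGETS = the six registered stubs of `Lines/blowdown-kills-pitch.lean`
  (skeleton `415f7ae75d4c`): none refuted; T1 (`stub_screwIsPeriodic`) TRUE with BOTH hypotheses
  load-bearing (`screwIsPeriodic_false_without_skew`: nilpotent shear + the polynomial field
  `(x₀ − x₁x₂)e_z`; `screwIsPeriodic_false_without_notInRange`: identity field for `A = J`); T2
  (`stub_rotationCovariance`) TRUE, its one missing ingredient proved here
  (`oseenKernel_map_linearIsometryEquiv`, full `O(3)`, reflections included — no parity exploit);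
  T3/T4/T5a un-witnessable; T1–T4 PROVED outright by this seat (candidate proofs attached; with F3
  they prove the route item `HelicalEndLiouville`, stmt-14062, by name — `HelicalEndLiouvilleCandidate.lean`,
  rc 0, 0 sorry); T5a = Tsai (closable); with the periodicity of T3
  load-bearing modulo `X` (`not_blowdownVanishingAll_of_not_typeIAncientLiouville`) and the GAUGE
  load-bearing in T4/T5a/T5b (`smallAtMinusInfinity_false_without_mild`,
  `selfSimilarLeaf_false_without_mild`, `rotatedSelfSimilar_false_without_mild`: parasitic,
  self-similar parasitic `(−t)^{-1/2}e₀`, and the NEW rotating parasitic field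
  `(−t)^{-1/2}R_{½log(−t)}e₀`, which satisfies the rotated-scaling clause exactly — so the
  PDE-level bounded-profile RSS Liouville statement is false and its honest form is "profile = constant
  vector rotating with the frame", the `α ≠ 0` twin of Tsai's `q = ∞` case); after the lead's reshape
  `e35ce922ec1c` the open core is T7 `stub_rssLiouvilleOfFarField` (decaying profiles), pinned below by
  `rssLiouvilleOfFarField_implies_rss_decaying` (T7 ⇒ §(b) `RotatedSelfSimilarLiouvilleDecaying` ⊇
  Pineau–Vicol Conj. 1.1 in the gauge) and `symmetricLiouville_implies_rssLiouvilleOfFarField`; T6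
  (`stub_rssFarFieldVanishing`) is PROVED by this seat (far-field recentring).
* (c) WHY IT RESISTS a cheap kill: every hypothesis of the class is a genuine (non-junk) condition
  for smooth bounded fields (heat flow = honest Gaussian convolution for `t − s > 0`; the Oseen
  double integral converges absolutely for bounded continuous `u`), so a counterexample must be a
  genuine nonzero Type-I ancient mild Navier–Stokes solution with a continuous similarity symmetry:
  translations / axisymmetric / backward self-similar (bounded profile) are excluded by tree facts
  (`KNSS2009_liouville_planar`, `AxisymmetricTypeIExclusion_holds`, `tsai_selfsimilar_bounded_holds`),
  and the remaining helical and rotated-self-similar cases are open problems with no candidate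
  solution in print. No finite/small model: the statement quantifies over smooth fields on ℝ³.
-/

noncomputable section

namespace Summit.NavierStokesRegularity.NavierStokesRegularity.Cruxes.SymmetricLiouville.Disproof

open Literature.Analysis.FluidPDE Literature.Analysis.UnboundedOperators MeasureTheory Set Function
open scoped RealInnerProductSpace FourierTransform Real

open Summit.NavierStokesRegularity.NavierStokesRegularity.Theses.SymmetryModuliCount
  (SymmetricLiouville)

/-- `ℝ³` as in the route file. -/
abbrev E3 : Type := EuclideanSpace ℝ (Fin 3)

/-! ## The crux unbundled -/

/-- Smoothness clause of the class `𝒜_C`: `u` is jointly `C^∞` on `(−∞,0) × ℝ³`. -/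
def IsSmoothAncient (u : ℝ → E3 → E3) : Prop :=
  ContDiffOn ℝ (⊤ : ℕ∞) (Function.uncurry u) (Set.Iio 0 ×ˢ Set.univ)

/-- Divergence-free clause of `𝒜_C`. -/
def IsDivFreeAncient (u : ℝ → E3 → E3) : Prop :=
  ∀ t < 0, VectorCalculus.IsDivFree (u t)

/-- The KNSS-gauge clause of `𝒜_C`: the Oseen integral equation between all times `s < t < 0`,
verbatim from the crux. -/
def IsKNSSMild (u : ℝ → E3 → E3) : Prop :=
  ∀ s t : ℝ, s < t → t < 0 → ∀ x, u t x = heatFlow (u s) (t - s) x -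
    ∫ τ in Set.Ioo s t, ∫ y, oseenKernel (t - τ) (x - y) (u τ y) (u τ y)

/-- Membership in the Type-I moduli class `𝒜_C` of the route (the four hypotheses of the crux). -/
def InClass (C : ℝ) (u : ℝ → E3 → E3) : Prop :=
  IsSmoothAncient u ∧ IsDivFreeAncient u ∧ IsKNSSMild u ∧ HasTypeITimeDecay C u

/-- Skew-symmetry of the rotation generator, as written in the crux. -/
def IsSkew (A : E3 →L[ℝ] E3) : Prop := ∀ x, ⟪A x, x⟫ = 0

/-- `L_ξ u ≡ 0` on `t < 0` for `ξ = (a, σ, A)`: the symmetry clause of the crux, verbatim. -/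
def HasSymmetry (u : ℝ → E3 → E3) (a : E3) (σ : ℝ) (A : E3 →L[ℝ] E3) : Prop :=
  ∀ t < 0, ∀ x, fderiv ℝ (u t) x (a + σ • x + A x) + σ • u t x +
    (2 * σ * t) • timeDeriv u t x - A (u t x) = 0

/-- The conclusion of the crux. -/
def VanishesOnPast (u : ℝ → E3 → E3) : Prop := ∀ t < 0, ∀ x, u t x = 0

/-- The crux, unbundled; `Iff.rfl`, so the negative lemmas below speak about the route decl itself. -/
theorem symmetricLiouville_iff :
    SymmetricLiouville ↔ ∀ (C : ℝ) (u : ℝ → E3 → E3), InClass C u →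
      ∀ (a : E3) (σ : ℝ) (A : E3 →L[ℝ] E3), IsSkew A → ¬ (a = 0 ∧ σ = 0 ∧ A = 0) →
        HasSymmetry u a σ A → VanishesOnPast u :=
  Iff.rfl

/-! ## Two explicit fields -/

/-- The unit vector `e₀`. -/
def e0 : E3 := EuclideanSpace.single 0 1

/-- `‖e₀‖ = 1`. -/
theorem norm_e0 : ‖e0‖ = 1 := by
  simp [e0]

/-- `e₀ ≠ 0`. -/
theorem e0_ne_zero : e0 ≠ 0 := by
  intro h
  have := norm_e0
  rw [h, norm_zero] at this
  exact zero_ne_one this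

/-- The constant field `u ≡ e₀`. -/
def constField : ℝ → E3 → E3 := fun _ _ => e0

/-- The parasitic field `u(t, x) = (1 − t)⁻¹ • e₀` (spatially constant, Type-I with `C = 1`). -/
def parasiticField : ℝ → E3 → E3 := fun t _ => (1 - t)⁻¹ • e0

/-- The constant field is smooth. -/
theorem constField_smooth : IsSmoothAncient constField :=
  contDiffOn_const

/-- The parasitic field is smooth on `t < 0` (indeed on `t < 1`). -/
theorem parasiticField_smooth : IsSmoothAncient parasiticField := by
  unfold IsSmoothAncient parasiticField
  have h1 : ContDiffOn ℝ (⊤ : ℕ∞) (fun p : ℝ × E3 => (1 - p.1)⁻¹) (Set.Iio 0 ×ˢ Set.univ) := by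
    refine ContDiffOn.inv ?_ ?_
    · exact (contDiffOn_const.sub contDiff_fst.contDiffOn)
    · rintro ⟨t, x⟩ ⟨ht, -⟩
      simp only [Set.mem_Iio] at ht
      exact ne_of_gt (by linarith)
  exact h1.smul contDiffOn_const

/-- A spatially constant field is divergence free (its Fréchet derivative is `0`). -/
theorem isDivFree_const (c : E3) : VectorCalculus.IsDivFree (fun _ : E3 => c) := by
  intro x
  simp [VectorCalculus.divergence]

/-- The constant field is divergence free. -/
theorem constField_divFree : IsDivFreeAncient constField := fun _ _ => isDivFree_const e0

/-- The parasitic field is divergence free. -/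
theorem parasiticField_divFree : IsDivFreeAncient parasiticField := fun t _ =>
  isDivFree_const ((1 - t)⁻¹ • e0)

/-- **Gauge sanity, in Lean**: the constant field satisfies the in-tree KNSS/Oseen integral
equation — `e^{σΔ} c = c` (`heatExtension_const`, mass one of the Gauss–Weierstrass kernel) and
`∫ K(σ, x − y)[c, c] dy = 0` for every `σ` (`integral_oseenKernel_sub_left_eq_zero`, oddness of
the Koch–Tataru kernel; no integrability needed). KNSS 2009 Remark 6.1. -/
theorem constField_mild : IsKNSSMild constField := by
  intro s t hst _ht x
  have hσ : 0 < t - s := sub_pos.2 hst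
  have hcs : constField s = fun _ : E3 => e0 := rfl
  rw [hcs, heatFlow_of_pos _ hσ, Literature.Analysis.UnboundedOperators.heatExtension_const e0 hσ x]
  simp [constField, integral_oseenKernel_sub_left_eq_zero]

/-- A spatially constant field is invariant under every translation: `L_{(a,0,0)} u = a·∇u = 0`. -/
theorem hasSymmetry_translation_of_const (b : ℝ → E3) (a : E3) :
    HasSymmetry (fun t _ => b t) a 0 0 := by
  intro t _ x
  simp

/-- The constant field is invariant under the translation `ξ = (e₀, 0, 0)`. -/
theorem constField_symm : HasSymmetry constField e0 0 0 :=
  hasSymmetry_translation_of_const (fun _ => e0) e0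

/-- The parasitic field is invariant under the translation `ξ = (e₀, 0, 0)`. -/
theorem parasiticField_symm : HasSymmetry parasiticField e0 0 0 :=
  hasSymmetry_translation_of_const (fun t => (1 - t)⁻¹ • e0) e0

/-- `ξ = (e₀, 0, 0) ≠ 0`. -/
theorem xi_translation_ne_zero : ¬ (e0 = 0 ∧ (0 : ℝ) = 0 ∧ (0 : E3 →L[ℝ] E3) = 0) :=
  fun h => e0_ne_zero h.1

/-- The constant field does not vanish on the past. -/
theorem constField_not_vanishes : ¬ VanishesOnPast constField := by
  intro h
  exact e0_ne_zero (h (-1) (by norm_num) 0)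

/-- The parasitic field does not vanish on the past (`u(−1, 0) = ½ e₀`). -/
theorem parasiticField_not_vanishes : ¬ VanishesOnPast parasiticField := by
  intro h
  have h1 : ((1 : ℝ) - (-1))⁻¹ • e0 = 0 := h (-1) (by norm_num) 0
  rw [smul_eq_zero] at h1
  rcases h1 with h1 | h1
  · norm_num at h1
  · exact e0_ne_zero h1

/-- `√(−t) ≤ 1 − t` for `t < 0` (AM–GM), the inequality behind the Type-I bound of the
parasitic field. -/
theorem sqrt_neg_le_one_sub {t : ℝ} (ht : t < 0) : Real.sqrt (-t) ≤ 1 - t := by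
  rw [Real.sqrt_le_left (by linarith)]
  nlinarith [sq_nonneg (t + 1)]

/-- The parasitic field is Type-I with constant `1`: `(1 − t)⁻¹ ≤ 1/√(−t)`. -/
theorem parasiticField_typeI : HasTypeITimeDecay 1 parasiticField := by
  intro t ht x
  have hs : 0 < Real.sqrt (-t) := Real.sqrt_pos.2 (by linarith)
  have h1t : 0 < 1 - t := by linarith
  simp only [parasiticField, norm_smul, norm_inv, Real.norm_eq_abs, abs_of_pos h1t, norm_e0,
    mul_one]
  rw [inv_eq_one_div]
  exact div_le_div_of_nonneg_left zero_le_one hs (sqrt_neg_le_one_sub ht)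

/-- The constant field is bounded by `1`. -/
theorem constField_bounded : ∀ t < (0 : ℝ), ∀ x : E3, ‖constField t x‖ ≤ 1 := by
  intro t _ x
  simp [constField, norm_e0]

/-! ## (a) Load-bearing hypotheses -/

/-- The crux with the Type-I decay hypothesis DROPPED. -/
def SymmetricLiouvilleWithoutTypeI : Prop :=
  ∀ (u : ℝ → E3 → E3), IsSmoothAncient u → IsDivFreeAncient u → IsKNSSMild u →
    ∀ (a : E3) (σ : ℝ) (A : E3 →L[ℝ] E3), IsSkew A → ¬ (a = 0 ∧ σ = 0 ∧ A = 0) →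
      HasSymmetry u a σ A → VanishesOnPast u

/-- **Type-I decay is load-bearing.** Without `HasTypeITimeDecay` the crux is false: the constant
field `u ≡ e₀` is smooth, divergence free, satisfies the KNSS/Oseen integral equation (gauge sanity:
constants ARE in the gauge class, only time-dependent constants `b(t)` are not) and is invariant
under the translation `ξ = (e₀, 0, 0)`, yet `u ≠ 0`. (Refuter rreview note 2026-08-15, on paper;
here kernel-checked.) -/
theorem symmetricLiouville_false_without_typeI : ¬ SymmetricLiouvilleWithoutTypeI := fun h =>
  constField_not_vanishes (h constField constField_smooth constField_divFree constField_mild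
    e0 0 0 (fun x => by simp) xi_translation_ne_zero constField_symm)

/-- The crux with the KNSS-gauge (Oseen integral equation) hypothesis DROPPED. -/
def SymmetricLiouvilleWithoutMild : Prop :=
  ∀ (C : ℝ) (u : ℝ → E3 → E3), IsSmoothAncient u → IsDivFreeAncient u → HasTypeITimeDecay C u →
    ∀ (a : E3) (σ : ℝ) (A : E3 →L[ℝ] E3), IsSkew A → ¬ (a = 0 ∧ σ = 0 ∧ A = 0) →
      HasSymmetry u a σ A → VanishesOnPast u

/-- **The gauge is load-bearing.** Without the Oseen integral equation the crux is false: the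
parasitic field `u(t, x) = (1 − t)⁻¹ • e₀` (KNSS 2009 §1: the solutions `b(t)`, `∇p = −b'(t)·x`
that the mild formulation removes) is smooth on `t < 1`, divergence free, Type-I with `C = 1`
(`(1−t)⁻¹ ≤ (−t)^{-1/2}` by AM–GM) and translation invariant, yet nonzero. Consequently the crux is
false verbatim in any "very weak"/duality formulation that does not see spatial constants. -/
theorem symmetricLiouville_false_without_mild : ¬ SymmetricLiouvilleWithoutMild := fun h =>
  parasiticField_not_vanishes (h 1 parasiticField parasiticField_smooth parasiticField_divFree
    parasiticField_typeI e0 0 0 (fun x => by simp) xi_translation_ne_zero parasiticField_symm)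

/-- The crux with Type-I decay REPLACED by boundedness `‖u(t,x)‖ ≤ C` (the natural "bounded
ancient" version). -/
def SymmetricLiouvilleBounded : Prop :=
  ∀ (C : ℝ) (u : ℝ → E3 → E3), IsSmoothAncient u → IsDivFreeAncient u → IsKNSSMild u →
    (∀ t < 0, ∀ x, ‖u t x‖ ≤ C) →
    ∀ (a : E3) (σ : ℝ) (A : E3 →L[ℝ] E3), IsSkew A → ¬ (a = 0 ∧ σ = 0 ∧ A = 0) →
      HasSymmetry u a σ A → VanishesOnPast u

/-- **Refuted natural strengthening**: the bounded-ancient version with conclusion `u ≡ 0` is false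
(constant field). A bounded-ancient symmetric Liouville theorem must conclude "`u` is constant"
(as KNSS 2009 Thm 5.1 / Rem. 6.1 do); the Type-I rate is what upgrades "constant" to "zero". -/
theorem symmetricLiouville_false_with_bounded : ¬ SymmetricLiouvilleBounded := fun h =>
  constField_not_vanishes (h 1 constField constField_smooth constField_divFree constField_mild
    constField_bounded e0 0 0 (fun x => by simp) xi_translation_ne_zero constField_symm)

/-! ### Finer cuts: WHICH part of "Type-I" and of "mild" is used

Two more mutants, refuted by (faded) constants: the DECAY `u(t) → 0` as `t → −∞` hidden in the
Type-I bound is essential (not just the rate near `t = 0` plus boundedness), and the gauge condition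
must reach back to `t = −∞` (the Oseen equation on a final window only is not enough). -/

/-- The crux with Type-I decay assumed only on the final window `(−1, 0)` and mere BOUNDEDNESS on
the whole past. -/
def SymmetricLiouvilleTypeINearZeroBoundedPast : Prop :=
  ∀ (C : ℝ) (u : ℝ → E3 → E3), IsSmoothAncient u → IsDivFreeAncient u → IsKNSSMild u →
    (∀ t ∈ Set.Ioo (-1 : ℝ) 0, ∀ x, ‖u t x‖ ≤ C / Real.sqrt (-t)) → (∀ t < 0, ∀ x, ‖u t x‖ ≤ C) →
    ∀ (a : E3) (σ : ℝ) (A : E3 →L[ℝ] E3), IsSkew A → ¬ (a = 0 ∧ σ = 0 ∧ A = 0) →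
      HasSymmetry u a σ A → VanishesOnPast u

/-- **The decay at `t = −∞` is load-bearing**: Type-I on the final window plus boundedness of the
whole past does not suffice — the constant field `e₀` satisfies all of it (`1 ≤ 1/√(−t)` on
`(−1,0)`), is in the gauge class and translation invariant, yet nonzero. So a proof must use
`‖u(t)‖_∞ → 0` as `t → −∞` (equivalently, by KNSS Rem. 6.1-type arguments, that the only constant
in `𝒜_C` is `0`). -/
theorem symmetricLiouville_false_typeI_near_zero_bounded_past :
    ¬ SymmetricLiouvilleTypeINearZeroBoundedPast := by
  intro h
  refine constField_not_vanishes (h 1 constField constField_smooth constField_divFree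
    constField_mild ?_ constField_bounded e0 0 0 (fun x => by simp) xi_translation_ne_zero
    constField_symm)
  rintro t ⟨ht1, ht2⟩ x
  have hs : 0 < Real.sqrt (-t) := Real.sqrt_pos.2 (by linarith)
  have hs1 : Real.sqrt (-t) ≤ 1 := by
    rw [Real.sqrt_le_left zero_le_one]
    linarith
  rw [le_div_iff₀ hs]
  calc ‖constField t x‖ * Real.sqrt (-t) ≤ 1 * 1 := by
        gcongr
        · exact constField_bounded t ht2 x
    _ = 1 := one_mul _

/-- A smooth fade: `φ_T(t) = smoothTransition (t/T + 2)` equals `1` for `t ≥ −T`, `0` for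
`t ≤ −2T`, and takes values in `[0, 1]`. -/
def fade (T : ℝ) (t : ℝ) : ℝ := Real.smoothTransition (t / T + 2)

/-- `φ_T = 1` on `[−T, ∞)`. -/
theorem fade_eq_one {T t : ℝ} (hT : 0 < T) (ht : -T ≤ t) : fade T t = 1 := by
  unfold fade
  apply Real.smoothTransition.one_of_one_le
  have : -1 ≤ t / T := by rw [le_div_iff₀ hT]; linarith
  linarith

/-- `φ_T = 0` on `(−∞, −2T]`. -/
theorem fade_eq_zero {T t : ℝ} (hT : 0 < T) (ht : t ≤ -(2 * T)) : fade T t = 0 := by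
  unfold fade
  apply Real.smoothTransition.zero_of_nonpos
  have : t / T ≤ -2 := by rw [div_le_iff₀ hT]; linarith
  linarith

/-- `0 ≤ φ_T ≤ 1`. -/
theorem fade_mem_Icc (T t : ℝ) : fade T t ∈ Set.Icc (0 : ℝ) 1 :=
  ⟨Real.smoothTransition.nonneg _, Real.smoothTransition.le_one _⟩

/-- The **faded constant** `u(t, x) = φ_T(t) • e₀`: spatially constant, equal to `e₀` on the final
window `[−T, 0)` and to `0` for `t ≤ −2T`. -/
def fadedConst (T : ℝ) : ℝ → E3 → E3 := fun t _ => fade T t • e0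

/-- The faded constant is smooth. -/
theorem fadedConst_smooth (T : ℝ) : IsSmoothAncient (fadedConst T) := by
  have h : ContDiff ℝ (⊤ : ℕ∞) (fun p : ℝ × E3 => fade T p.1) :=
    Real.smoothTransition.contDiff.comp ((contDiff_fst.div_const T).add contDiff_const)
  exact (h.smul contDiff_const).contDiffOn

/-- The crux with the KNSS/Oseen integral equation assumed only between times of the final window
`(−T, 0)` (everything else — smoothness, divergence, Type-I decay, symmetry — for all `t < 0`). -/
def SymmetricLiouvilleMildOnWindow (T : ℝ) : Prop :=
  ∀ (C : ℝ) (u : ℝ → E3 → E3), IsSmoothAncient u → IsDivFreeAncient u →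
    (∀ s t : ℝ, -T < s → s < t → t < 0 → ∀ x, u t x = heatFlow (u s) (t - s) x -
        ∫ τ in Set.Ioo s t, ∫ y, oseenKernel (t - τ) (x - y) (u τ y) (u τ y)) →
    HasTypeITimeDecay C u →
    ∀ (a : E3) (σ : ℝ) (A : E3 →L[ℝ] E3), IsSkew A → ¬ (a = 0 ∧ σ = 0 ∧ A = 0) →
      HasSymmetry u a σ A → VanishesOnPast u

/-- **The gauge must reach `t = −∞`**: with the Oseen equation only on a final window `(−T, 0)`
the crux is FALSE for every `T > 0` — the faded constant `φ_T(t) e₀` is smooth, divergence free,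
Type-I on ALL of `t < 0` with `C = √(2T)` (it vanishes for `t ≤ −2T` and `√(−t) ≤ √(2T)` after),
translation invariant, satisfies the Oseen equation between any two times of the window (where it
is the constant `e₀`: `e^{σΔ}e₀ = e₀`, `∫K[e₀,e₀] dy = 0`), yet `u(−T/2) = e₀ ≠ 0`. (It is not in
`𝒜_C`: between `s < −2T` and `t > −T` the equation fails, `e₀ ≠ e^{(t−s)Δ}0 − 0`.) -/
theorem symmetricLiouville_false_mild_on_window {T : ℝ} (hT : 0 < T) :
    ¬ SymmetricLiouvilleMildOnWindow T := by
  intro h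
  have hval : ∀ t, -T ≤ t → ∀ x : E3, fadedConst T t x = e0 := fun t ht x => by
    simp [fadedConst, fade_eq_one hT ht]
  have hne : ¬ VanishesOnPast (fadedConst T) := by
    intro hv
    have := hv (-T / 2) (by linarith) 0
    rw [hval (-T / 2) (by linarith)] at this
    exact e0_ne_zero this
  refine hne (h (Real.sqrt (2 * T)) (fadedConst T) (fadedConst_smooth T)
    (fun t _ => isDivFree_const _) ?_ ?_ e0 0 0 (fun x => by simp) xi_translation_ne_zero
    (hasSymmetry_translation_of_const (fun t => fade T t • e0) e0))
  · -- the Oseen equation on the window, where the field is the constant `e₀`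
    intro s t hs hst _ x
    have hσ : 0 < t - s := sub_pos.2 hst
    have hus : fadedConst T s = fun _ : E3 => e0 := funext (hval s hs.le)
    rw [hval t (by linarith) x, hus, heatFlow_of_pos _ hσ,
      Literature.Analysis.UnboundedOperators.heatExtension_const e0 hσ x]
    have hD : ∫ τ in Set.Ioo s t, ∫ y, oseenKernel (t - τ) (x - y) (fadedConst T τ y)
        (fadedConst T τ y) = 0 := by
      refine setIntegral_eq_zero_of_forall_eq_zero fun τ hτ => ?_
      have hτ' : -T ≤ τ := by linarith [hτ.1]
      simp only [hval τ hτ']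
      exact integral_oseenKernel_sub_left_eq_zero _ x _ _
    rw [hD, sub_zero]
  · -- Type-I on all of `t < 0` with `C = √(2T)`
    intro t ht x
    have hst : 0 < Real.sqrt (-t) := Real.sqrt_pos.2 (by linarith)
    rcases le_or_gt t (-(2 * T)) with h2 | h2
    · have : fadedConst T t x = 0 := by simp [fadedConst, fade_eq_zero hT h2]
      rw [this, norm_zero]
      positivity
    · have hle : Real.sqrt (-t) ≤ Real.sqrt (2 * T) := Real.sqrt_le_sqrt (by linarith)
      rw [le_div_iff₀ hst]
      have hn : ‖fadedConst T t x‖ ≤ 1 := by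
        simp only [fadedConst, norm_smul, norm_e0, mul_one, Real.norm_eq_abs,
          abs_of_nonneg (fade_mem_Icc T t).1]
        exact (fade_mem_Icc T t).2
      calc ‖fadedConst T t x‖ * Real.sqrt (-t) ≤ 1 * Real.sqrt (2 * T) := by gcongr
        _ = Real.sqrt (2 * T) := one_mul _

/-! ## (a′) "Ancient" is load-bearing: the crux on a finite backward window is false

Witness: the viscous shear wave (Kolmogorov mode) `u(t,y) = e^{−4π²t} sin(2π y₀) e₁`, an exact
Navier–Stokes solution with vanishing nonlinearity. Ingredients: the heat flow of a plane wave
(`heatExtension_shear`, from the tree's `fourierIntegral_heatKernel_holds`) and the vanishing of the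
Oseen–Duhamel term on tensors independent of the divergence coordinate (the tree's
`integral_oseenKernel_sub_smul_single_left`, Fubini along lines). -/


/-- Unit vector along Lean coordinate `1` (direction of the shear velocity). -/
def e1 : E3 := EuclideanSpace.single 1 1

/-- Unit vector along Lean coordinate `0` (direction of the shear wave vector). -/
def f0 : E3 := EuclideanSpace.single 0 1

/-- `‖e₁‖ = 1`. -/
theorem norm_e1 : ‖e1‖ = 1 := by simp [e1]

/-- `‖f₀‖ = 1`. -/
theorem norm_f0 : ‖f0‖ = 1 := by simp [f0]

/-- `⟪v, f₀⟫ = v₀`. -/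
theorem inner_f0 (v : E3) : ⟪v, f0⟫ = v 0 := by simp [f0, EuclideanSpace.inner_single_right]

/-- `e₁ ≠ 0`. -/
theorem e1_ne_zero : e1 ≠ 0 := by
  intro h
  have := norm_e1
  rw [h, norm_zero] at this
  exact zero_ne_one this

/-- `e₁` has vanishing `0`-th coordinate. -/
theorem e1_apply_zero : e1 0 = 0 := by simp [e1]

/-- Continuity of `v ↦ v₀` on `ℝ³`. -/
theorem continuous_coord0 : Continuous fun v : E3 => v 0 :=
  (EuclideanSpace.proj (0 : Fin 3) : E3 →L[ℝ] ℝ).continuous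

/-! ### The Gauss–Weierstrass kernel against the plane wave `e^{2πi y₀}` -/

/-- `𝓕 G_σ (f₀) = e^{−4π²σ}` written out: `∫ e^{−2πi v₀} G_σ(v) dv = e^{−4π²σ}`. -/
theorem fourier_heatKernel_f0 {σ : ℝ} (hσ : 0 < σ) :
    ∫ v : E3, Complex.exp (↑(-2 * π * v 0) * Complex.I) • (heatKernel σ v : ℂ) =
      (Real.exp (-(4 * π ^ 2 * σ)) : ℂ) := by
  have hF := fourierIntegral_heatKernel_holds (E := E3) hσ f0
  rw [Real.fourier_eq'] at hF
  simp only [inner_f0] at hF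
  rw [hF, heatSymbol, norm_f0]
  push_cast
  ring_nf

/-- Integrability of the Fourier integrand. -/
theorem integrable_cexp_smul_heatKernel {σ : ℝ} (hσ : 0 < σ) :
    Integrable (fun v : E3 => Complex.exp (↑(-2 * π * v 0) * Complex.I) • (heatKernel σ v : ℂ)) := by
  have hG : Integrable (fun v : E3 => (heatKernel σ v : ℂ)) :=
    (integrable_heatKernel_holds (E := E3) hσ).ofReal
  have h1 : Continuous fun v : E3 => Complex.exp (↑(-2 * π * v 0) * Complex.I) :=
    Complex.continuous_exp.comp
      ((Complex.continuous_ofReal.comp (continuous_const.mul continuous_coord0)).mul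
        continuous_const)
  have h2 : Continuous fun v : E3 => (heatKernel σ v : ℂ) :=
    Complex.continuous_ofReal.comp (continuous_heatKernel (E := E3) σ)
  refine hG.norm.mono' (h1.smul h2).aestronglyMeasurable (Filter.Eventually.of_forall fun v => ?_)
  rw [norm_smul, Complex.norm_exp_ofReal_mul_I, one_mul]

/-- `∫ G_σ(v) cos(2π v₀) dv = e^{−4π²σ}` (real part of `fourier_heatKernel_f0`). -/
theorem integral_heatKernel_mul_cos {σ : ℝ} (hσ : 0 < σ) :
    ∫ v : E3, heatKernel σ v * Real.cos (2 * π * v 0) = Real.exp (-(4 * π ^ 2 * σ)) := by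
  have h := congrArg Complex.re (fourier_heatKernel_f0 hσ)
  have h2 := integral_re (integrable_cexp_smul_heatKernel hσ)
  simp only [RCLike.re_to_complex] at h2
  rw [← h2] at h
  have hre : ∀ v : E3, (Complex.exp (↑(-2 * π * v 0) * Complex.I) • (heatKernel σ v : ℂ)).re =
      heatKernel σ v * Real.cos (2 * π * v 0) := by
    intro v
    rw [smul_eq_mul, Complex.mul_re, Complex.exp_ofReal_mul_I_re, Complex.exp_ofReal_mul_I_im,
      Complex.ofReal_re, Complex.ofReal_im, mul_zero, sub_zero]
    rw [show -2 * π * v 0 = -(2 * π * v 0) by ring, Real.cos_neg, mul_comm]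
  simp_rw [hre] at h
  rw [h, Complex.ofReal_re]

/-- `∫ G_σ(v) sin(2π v₀) dv = 0` (imaginary part of `fourier_heatKernel_f0`). -/
theorem integral_heatKernel_mul_sin {σ : ℝ} (hσ : 0 < σ) :
    ∫ v : E3, heatKernel σ v * Real.sin (2 * π * v 0) = 0 := by
  have h := congrArg Complex.im (fourier_heatKernel_f0 hσ)
  have h2 := integral_im (integrable_cexp_smul_heatKernel hσ)
  simp only [RCLike.im_to_complex] at h2
  rw [← h2] at h
  have him : ∀ v : E3, (Complex.exp (↑(-2 * π * v 0) * Complex.I) • (heatKernel σ v : ℂ)).im =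
      -(heatKernel σ v * Real.sin (2 * π * v 0)) := by
    intro v
    rw [smul_eq_mul, Complex.mul_im, Complex.exp_ofReal_mul_I_re, Complex.exp_ofReal_mul_I_im,
      Complex.ofReal_re, Complex.ofReal_im, mul_zero, zero_add]
    rw [show -2 * π * v 0 = -(2 * π * v 0) by ring, Real.sin_neg]
    ring
  simp_rw [him] at h
  rw [integral_neg, Complex.ofReal_im, neg_eq_zero] at h
  exact h

/-- `G_σ · φ` is integrable for a continuous `φ` with `|φ| ≤ 1`. -/
theorem integrable_heatKernel_mul {σ : ℝ} (hσ : 0 < σ) {φ : E3 → ℝ} (hφ : Continuous φ)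
    (hb : ∀ v, |φ v| ≤ 1) : Integrable (fun v : E3 => heatKernel σ v * φ v) := by
  refine (integrable_heatKernel_holds (E := E3) hσ).norm.mono'
    ((continuous_heatKernel σ).mul hφ).aestronglyMeasurable (Filter.Eventually.of_forall fun v => ?_)
  rw [norm_mul, Real.norm_eq_abs, Real.norm_eq_abs]
  calc |heatKernel σ v| * |φ v| ≤ |heatKernel σ v| * 1 := by gcongr; exact hb v
    _ = |heatKernel σ v| := mul_one _

/-- **Heat flow of the shear mode**: `e^{σΔ}[(c sin(2π y₀)) e₁](x) = c e^{−4π²σ} sin(2π x₀) e₁`. -/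
theorem heatExtension_shear {σ : ℝ} (hσ : 0 < σ) (c : ℝ) (x : E3) :
    heatExtension (fun y : E3 => (c * Real.sin (2 * π * y 0)) • e1) σ x =
      (c * Real.exp (-(4 * π ^ 2 * σ)) * Real.sin (2 * π * x 0)) • e1 := by
  rw [heatExtension_apply]
  simp_rw [smul_smul]
  rw [integral_smul_const]
  congr 1
  have hsplit : ∀ y : E3, heatKernel σ y * (c * Real.sin (2 * π * (x - y) 0)) =
      c * Real.sin (2 * π * x 0) * (heatKernel σ y * Real.cos (2 * π * y 0)) -
        c * Real.cos (2 * π * x 0) * (heatKernel σ y * Real.sin (2 * π * y 0)) := by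
    intro y
    rw [PiLp.sub_apply, mul_sub, Real.sin_sub]
    ring
  simp_rw [hsplit]
  have hc : Integrable fun v : E3 => heatKernel σ v * Real.cos (2 * π * v 0) :=
    integrable_heatKernel_mul hσ (Real.continuous_cos.comp (continuous_const.mul continuous_coord0))
      fun v => Real.abs_cos_le_one _
  have hs : Integrable fun v : E3 => heatKernel σ v * Real.sin (2 * π * v 0) :=
    integrable_heatKernel_mul hσ (Real.continuous_sin.comp (continuous_const.mul continuous_coord0))
      fun v => Real.abs_sin_le_one _
  rw [integral_sub (hc.const_mul _) (hs.const_mul _), integral_const_mul, integral_const_mul,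
    integral_heatKernel_mul_cos hσ, integral_heatKernel_mul_sin hσ]
  ring

/-! ### The decaying viscous shear wave -/

/-- The **viscous shear wave** (Kolmogorov mode) `u(t, y) = e^{−4π²t} sin(2π y₀) e₁`, an exact
smooth divergence-free Navier–Stokes solution on all of `ℝ × ℝ³` (`(u·∇)u = 0`, `p = const`),
invariant under translations along `e₁` and `e₂`, and growing like `e^{4π²|t|}` as `t → −∞`. -/
def shearWave : ℝ → E3 → E3 := fun t y =>
  (Real.exp (-(4 * π ^ 2 * t)) * Real.sin (2 * π * y 0)) • e1

/-- The shear wave is jointly smooth (everywhere). -/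
theorem shearWave_contDiff : ContDiff ℝ (⊤ : ℕ∞) (Function.uncurry shearWave) := by
  have h1 : ContDiff ℝ (⊤ : ℕ∞) (fun p : ℝ × E3 => Real.exp (-(4 * π ^ 2 * p.1))) :=
    Real.contDiff_exp.comp (contDiff_const.mul contDiff_fst).neg
  have h2 : ContDiff ℝ (⊤ : ℕ∞) (fun p : ℝ × E3 => Real.sin (2 * π * p.2 0)) :=
    Real.contDiff_sin.comp (contDiff_const.mul
      ((EuclideanSpace.proj (0 : Fin 3) : E3 →L[ℝ] ℝ).contDiff.comp contDiff_snd))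
  exact (h1.mul h2).smul contDiff_const

/-- The Fréchet derivative of a slice of the shear wave. -/
theorem hasFDerivAt_shearWave (t : ℝ) (y : E3) :
    HasFDerivAt (shearWave t)
      ((Real.exp (-(4 * π ^ 2 * t)) • (Real.cos (2 * π * y 0) •
        ((2 * π) • (EuclideanSpace.proj (0 : Fin 3) : E3 →L[ℝ] ℝ)))).smulRight e1) y := by
  have h0 : HasFDerivAt (fun v : E3 => v 0) (EuclideanSpace.proj (0 : Fin 3) : E3 →L[ℝ] ℝ) y :=
    (EuclideanSpace.proj (0 : Fin 3) : E3 →L[ℝ] ℝ).hasFDerivAt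
  have h1 : HasFDerivAt (fun v : E3 => 2 * π * v 0)
      ((2 * π) • (EuclideanSpace.proj (0 : Fin 3) : E3 →L[ℝ] ℝ)) y := h0.const_mul (2 * π)
  have h2 : HasFDerivAt (fun v : E3 => Real.sin (2 * π * v 0))
      (Real.cos (2 * π * y 0) • ((2 * π) • (EuclideanSpace.proj (0 : Fin 3) : E3 →L[ℝ] ℝ))) y :=
    (Real.hasDerivAt_sin _).comp_hasFDerivAt y h1
  have h3 := (h2.const_mul (Real.exp (-(4 * π ^ 2 * t)))).smul_const e1
  exact h3

/-- The slice derivative, evaluated. -/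
theorem fderiv_shearWave_apply (t : ℝ) (y v : E3) :
    fderiv ℝ (shearWave t) y v =
      (Real.exp (-(4 * π ^ 2 * t)) * (Real.cos (2 * π * y 0) * (2 * π * v 0))) • e1 := by
  rw [(hasFDerivAt_shearWave t y).fderiv]
  simp [ContinuousLinearMap.smulRight_apply, mul_assoc]

/-- The shear wave is divergence free (its velocity is along `e₁`, its gradient along `f₀ ⊥ e₁`). -/
theorem shearWave_divFree (t : ℝ) : VectorCalculus.IsDivFree (shearWave t) := by
  intro y
  rw [divergence_eq_sum_inner_fderiv (EuclideanSpace.basisFun (Fin 3) ℝ) (shearWave t) y,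
    Fin.sum_univ_three]
  simp [fderiv_shearWave_apply, e1, EuclideanSpace.inner_single_left, inner_smul_right]

/-- The shear wave is invariant under translations along `e₁`: `e₁·∇u = 0`. -/
theorem shearWave_symm (t : ℝ) (y : E3) :
    fderiv ℝ (shearWave t) y (e1 + (0 : ℝ) • y + (0 : E3 →L[ℝ] E3) y) + (0 : ℝ) • shearWave t y +
      (2 * (0 : ℝ) * t) • timeDeriv shearWave t y - (0 : E3 →L[ℝ] E3) (shearWave t y) = 0 := by
  simp [fderiv_shearWave_apply, e1_apply_zero]

/-- Size of the shear wave: `‖u(t, y)‖ ≤ e^{−4π²t}`. -/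
theorem norm_shearWave_le (t : ℝ) (y : E3) : ‖shearWave t y‖ ≤ Real.exp (-(4 * π ^ 2 * t)) := by
  simp only [shearWave, norm_smul, norm_e1, mul_one, norm_mul, Real.norm_eq_abs,
    abs_of_pos (Real.exp_pos _)]
  calc Real.exp (-(4 * π ^ 2 * t)) * |Real.sin (2 * π * y 0)|
      ≤ Real.exp (-(4 * π ^ 2 * t)) * 1 := by gcongr; exact Real.abs_sin_le_one _
    _ = Real.exp (-(4 * π ^ 2 * t)) := mul_one _

/-- The shear wave does not vanish: `u(t, ¼f₀) = e^{−4π²t} e₁ ≠ 0`. -/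
theorem shearWave_ne_zero (t : ℝ) : shearWave t ((1 / 4 : ℝ) • f0) ≠ 0 := by
  have hq : ((1 / 4 : ℝ) • f0) 0 = 1 / 4 := by simp [f0]
  have hsin : Real.sin (2 * π * (1 / 4 : ℝ)) = 1 := by
    rw [show 2 * π * (1 / 4 : ℝ) = π / 2 by ring, Real.sin_pi_div_two]
  have hval : shearWave t ((1 / 4 : ℝ) • f0) = Real.exp (-(4 * π ^ 2 * t)) • e1 := by
    show (Real.exp (-(4 * π ^ 2 * t)) * Real.sin (2 * π * ((1 / 4 : ℝ) • f0) 0)) • e1 = _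
    rw [hq, hsin, mul_one]
  rw [hval, Ne, smul_eq_zero, not_or]
  exact ⟨(Real.exp_pos _).ne', e1_ne_zero⟩

/-- **The shear wave satisfies the KNSS/Oseen integral equation between ANY two times `s < t`.**
Heat part: `heatExtension_shear`; Duhamel part: the tensor `u ⊗ u = g² e₁ ⊗ e₁` with `g`
independent of `y₁` has `∂₁`-divergence zero, so `∫ K(t−τ, x−y)[u, u] dy = 0`
(`integral_oseenKernel_sub_smul_single_left`, Fubini along the lines parallel to `e₁`). -/
theorem shearWave_mild (s t : ℝ) (hst : s < t) (x : E3) :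
    shearWave t x = heatFlow (shearWave s) (t - s) x -
      ∫ τ in Set.Ioo s t, ∫ y, oseenKernel (t - τ) (x - y) (shearWave τ y) (shearWave τ y) := by
  have hσ : 0 < t - s := sub_pos.2 hst
  have hD : ∫ τ in Set.Ioo s t, ∫ y, oseenKernel (t - τ) (x - y) (shearWave τ y) (shearWave τ y) =
      0 := by
    refine setIntegral_eq_zero_of_forall_eq_zero fun τ hτ => ?_
    have hτ' : 0 < t - τ := sub_pos.2 hτ.2
    have hg : Continuous fun y : E3 => Real.exp (-(4 * π ^ 2 * τ)) * Real.sin (2 * π * y 0) :=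
      continuous_const.mul (Real.continuous_sin.comp (continuous_const.mul continuous_coord0))
    have hc : Continuous (shearWave τ) := hg.smul continuous_const
    have key := integral_oseenKernel_sub_smul_single_left hτ'
      (g := fun y : E3 => Real.exp (-(4 * π ^ 2 * τ)) * Real.sin (2 * π * y 0))
      (c := shearWave τ) hg.aestronglyMeasurable hc.aestronglyMeasurable
      (Mg := Real.exp (-(4 * π ^ 2 * τ))) (Mc := Real.exp (-(4 * π ^ 2 * τ)))
      (fun y => ?_) (fun y => norm_shearWave_le τ y) (fun y δ => ?_) (fun y δ => ?_) x
    · simpa [shearWave, e1] using key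
    · rw [abs_mul, abs_of_pos (Real.exp_pos _)]
      calc Real.exp (-(4 * π ^ 2 * τ)) * |Real.sin (2 * π * y 0)|
          ≤ Real.exp (-(4 * π ^ 2 * τ)) * 1 := by gcongr; exact Real.abs_sin_le_one _
        _ = Real.exp (-(4 * π ^ 2 * τ)) := mul_one _
    · simp
    · simp [shearWave]
  rw [hD, sub_zero, heatFlow_of_pos _ hσ]
  have hs : shearWave s = fun y : E3 =>
      (Real.exp (-(4 * π ^ 2 * s)) * Real.sin (2 * π * y 0)) • e1 := rfl
  rw [hs, heatExtension_shear hσ]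
  simp only [shearWave]
  congr 1
  rw [← Real.exp_add]
  ring_nf

/-! ### The window mutant and its refutation -/

/-- The crux with "ancient" weakened to a FINITE backward window `(−T, 0)`: the four class
hypotheses and the symmetry are assumed, and the conclusion asserted, only for times in
`(−T, 0)` (the Oseen integral equation between all `−T < s < t < 0`). -/
def SymmetricLiouvilleOnWindow (T : ℝ) : Prop :=
  ∀ (C : ℝ) (u : ℝ → E3 → E3),
    ContDiffOn ℝ (⊤ : ℕ∞) (Function.uncurry u) (Set.Ioo (-T) 0 ×ˢ Set.univ) →
    (∀ t ∈ Set.Ioo (-T) 0, VectorCalculus.IsDivFree (u t)) →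
    (∀ s t : ℝ, -T < s → s < t → t < 0 → ∀ x, u t x = heatFlow (u s) (t - s) x -
        ∫ τ in Set.Ioo s t, ∫ y, oseenKernel (t - τ) (x - y) (u τ y) (u τ y)) →
    (∀ t ∈ Set.Ioo (-T) 0, ∀ x, ‖u t x‖ ≤ C / Real.sqrt (-t)) →
    ∀ (a : E3) (σ : ℝ) (A : E3 →L[ℝ] E3), IsSkew A → ¬ (a = 0 ∧ σ = 0 ∧ A = 0) →
      (∀ t ∈ Set.Ioo (-T) 0, ∀ x, fderiv ℝ (u t) x (a + σ • x + A x) + σ • u t x +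
        (2 * σ * t) • timeDeriv u t x - A (u t x) = 0) →
      ∀ t ∈ Set.Ioo (-T) 0, ∀ x, u t x = 0

/-- **"Ancient" is load-bearing**: on every finite backward window the crux is FALSE. Witness:
the viscous shear wave `e^{−4π²t} sin(2π y₀) e₁`, which on `(−T, 0)` is smooth, divergence free,
KNSS-mild between any two times, Type-I with `C = e^{4π²T}√T` (it is bounded by `e^{4π²T}` there,
and `√(−t) ≤ √T`), translation invariant along `e₁`, and nonzero. It is NOT a counterexample to
the crux because it grows like `e^{4π²|t|}` as `t → −∞`: any proof must use the behaviour of `u`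
for `t → −∞` (the Type-I bound GLOBALLY in time), not just the equation and the rate near `t = 0`. -/
theorem symmetricLiouville_false_on_window {T : ℝ} (hT : 0 < T) : ¬ SymmetricLiouvilleOnWindow T := by
  intro h
  have hT2 : -T / 2 ∈ Set.Ioo (-T) 0 := ⟨by linarith, by linarith⟩
  refine shearWave_ne_zero (-T / 2) (h (Real.exp (4 * π ^ 2 * T) * Real.sqrt T) shearWave
    shearWave_contDiff.contDiffOn (fun t _ => shearWave_divFree t)
    (fun s t _ hst _ x => shearWave_mild s t hst x) ?_ e1 0 0 (fun x => by simp)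
    (fun hz => ?_) (fun t _ y => shearWave_symm t y) (-T / 2) hT2 _)
  · rintro t ⟨ht1, ht2⟩ y
    have hst : 0 < Real.sqrt (-t) := Real.sqrt_pos.2 (by linarith)
    have hsT : Real.sqrt (-t) ≤ Real.sqrt T := Real.sqrt_le_sqrt (by linarith)
    have hTpos : 0 < Real.sqrt T := Real.sqrt_pos.2 hT
    calc ‖shearWave t y‖ ≤ Real.exp (-(4 * π ^ 2 * t)) := norm_shearWave_le t y
      _ ≤ Real.exp (4 * π ^ 2 * T) := Real.exp_le_exp.2 (by nlinarith [Real.pi_pos])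
      _ = Real.exp (4 * π ^ 2 * T) * Real.sqrt T / Real.sqrt T := by
          field_simp
      _ ≤ Real.exp (4 * π ^ 2 * T) * Real.sqrt T / Real.sqrt (-t) :=
          div_le_div_of_nonneg_left (by positivity) hst hsT
  · have := norm_e1
    rw [hz.1, norm_zero] at this
    exact zero_ne_one this

/-- The window family is a genuine STRENGTHENING of the crux: if the statement held on every
finite window it would give the crux (restrict an element of `𝒜_C` to `(−T, 0)` with `T > −t`). -/
theorem symmetricLiouville_of_forall_window (h : ∀ T > 0, SymmetricLiouvilleOnWindow T) :
    SymmetricLiouville := by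
  intro C u hu a σ A hA hne hL t ht x
  obtain ⟨hs, hd, hm, hT⟩ := hu
  have hTpos : 0 < -t + 1 := by linarith
  have htI : t ∈ Set.Ioo (-(-t + 1)) 0 := ⟨by linarith, ht⟩
  refine h (-t + 1) hTpos C u (hs.mono (Set.prod_mono Set.Ioo_subset_Iio_self le_rfl))
    (fun t' ht' => hd t' ht'.2) (fun s' t' _ hst' ht'' x' => hm s' t' hst' ht'' x')
    (fun t' ht' x' => hT t' ht'.2 x') a σ A hA hne (fun t' ht' x' => hL t' ht'.2 x') t htI x

/-! ## (0) Sanity: non-vacuity, the trivial regime, position inside the route -/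

open Summit.NavierStokesRegularity.NavierStokesRegularity.Theses.SymmetryModuliCount
  (TypeIAncientLiouville ForcedSymmetry)

/-- The zero field satisfies the KNSS/Oseen integral equation (`e^{σΔ}0 = 0`, `K[0,0] = 0`). -/
theorem zero_mild : IsKNSSMild (fun _ _ => (0 : E3)) := by
  intro s t hst _ x
  have hσ : 0 < t - s := sub_pos.2 hst
  rw [heatFlow_of_pos _ hσ, Literature.Analysis.UnboundedOperators.heatExtension_const (0 : E3) hσ x]
  simp

/-- **Non-vacuity**: `0 ∈ 𝒜_C` for every `C ≥ 0` (so the hypotheses of the crux are satisfiable and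
the statement is not true for lack of instances). The only KNOWN element of `𝒜_C` is `0`. -/
theorem inClass_zero {C : ℝ} (hC : 0 ≤ C) : InClass C (fun _ _ => (0 : E3)) := by
  refine ⟨contDiffOn_const, fun _ _ => isDivFree_const 0, zero_mild, ?_⟩
  intro t _ x
  simp only [norm_zero]
  positivity

/-- **Trivial regime**: for `C ≤ 0` the class is `{0}` (indeed empty for `C < 0`), so the crux holds
there for free; it is contentful only for `C` above the perturbative threshold. -/
theorem vanishes_of_typeI_nonpos {C : ℝ} (hC : C ≤ 0) {u : ℝ → E3 → E3}
    (h : HasTypeITimeDecay C u) : VanishesOnPast u := by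
  intro t ht x
  have h1 := h t ht x
  have h2 : C / Real.sqrt (-t) ≤ 0 :=
    div_nonpos_of_nonpos_of_nonneg hC (Real.sqrt_nonneg _)
  exact norm_le_zero_iff.1 (h1.trans h2)

/-- The crux restricted to `C ≤ 0` holds (trivial regime). -/
theorem symmetricLiouville_of_nonpos (C : ℝ) (hC : C ≤ 0) (u : ℝ → E3 → E3) (hu : InClass C u) :
    VanishesOnPast u :=
  vanishes_of_typeI_nonpos hC hu.2.2.2

/-- The target `X = TypeIAncientLiouville` implies the crux (the crux is a WEAKENING of `X`): a
refutation of the crux would refute `X` and close the whole route (KILL CRITERIA of the thesis). -/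
theorem symmetricLiouville_of_typeIAncientLiouville : TypeIAncientLiouville → SymmetricLiouville :=
  fun hX C u hu _ _ _ _ _ _ => hX C u hu

/-- `X` implies `ForcedSymmetry` (vacuously: `X` empties the class, and `0` is translation
invariant). -/
theorem forcedSymmetry_of_typeIAncientLiouville : TypeIAncientLiouville → ForcedSymmetry := by
  intro hX C u hu
  refine ⟨e0, 0, 0, fun x => by simp, xi_translation_ne_zero, ?_⟩
  intro t ht x
  have hu0 : u t = fun _ => 0 := funext fun y => hX C u hu t ht y
  simp [hu0]

/-- **Position inside the route**: `X ⇔ ForcedSymmetry ∧ SymmetricLiouville` (the card's dichotomy;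
`←` is Step 1 of the route's deciding theorem). So the crux is exactly what is left of `X` once
every element of `𝒜_C` is known to carry an infinitesimal similarity symmetry. -/
theorem typeIAncientLiouville_iff_forced_and_symmetric :
    TypeIAncientLiouville ↔ ForcedSymmetry ∧ SymmetricLiouville := by
  refine ⟨fun hX => ⟨forcedSymmetry_of_typeIAncientLiouville hX,
    symmetricLiouville_of_typeIAncientLiouville hX⟩, fun ⟨hF, hS⟩ => ?_⟩
  intro C u hu
  obtain ⟨a, σ, A, hA, hne, hL⟩ := hF C u hu
  exact hS C u hu a σ A hA hne hL

/-! ## (b) Barrier reductions: the open sub-cases the crux contains -/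

/-- **Helical Type-I ancient Liouville** (screw motions of NONZERO pitch): `u ∈ 𝒜_C` invariant
under the screw motion generated by `ξ = (a, 0, A)` with `A ≠ 0` skew and `a ≠ 0` on the axis of
`A` (`A a = 0`) vanishes. Not in print as such (only the STEADY helical Liouville theorem exists,
Han–Wang–Xie, Sci. China Math. 69 (2026), doi:10.1007/s11425-024-2420-6), BUT — disprover's
assessment after checking the crux idea cards `screw-lattice-blowdown` / `blowdown-kills-pitch` /
`stabiliser-at-infinity-decay` (2026-08-16) — very likely CLOSABLE with known tools, hence a poor
place to look for a counterexample: (i) a screw of pitch `h` contains the translation by `2πh·axis`,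
so `u` is periodic along the axis; (ii) far from the axis (`r/√(−t) → ∞`) parabolic recentring turns
the screw into a translation, the recentred limits are translation-invariant Type-I ancient elements
(w.r.t. a shifted blow-up time), hence `0` by the planar leaf — so `√(−t)|u| → 0` as `r/√(−t) → ∞`
uniformly in `t`; (iii) blow-DOWN centred on the axis (`λ → ∞`, same class `𝒜_C`) shrinks the period
to `0`, the limit is independent of the axial coordinate, hence `0` — so `√(−t)‖u(t)‖_∞ → 0` as
`t → −∞`; (iv) the perturbative Liouville `ε(t) := √(−t)‖u(t)‖_∞ ≤ c·sup_{τ<t} ε(τ)²` (Oseen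
equation from `s = −∞`, kernel bound (14)) then forces `u = 0` on some `(−∞, T)`, and forward
uniqueness of bounded mild solutions gives `u ≡ 0`. Inputs: compactness of `𝒜_C` under local smooth
convergence (KNSS 2009 Prop. 4.1 bounds + dominated convergence in the Oseen equation) and leaf (T).
(For pitch `0` step (iii) does not reduce the dimension — that is why the axisymmetric leaf needed
Seregin–Šverák.) -/
def HelicalTypeILiouville : Prop :=
  ∀ (C : ℝ) (u : ℝ → E3 → E3), InClass C u →
    ∀ (a : E3) (A : E3 →L[ℝ] E3), IsSkew A → A ≠ 0 → a ≠ 0 → A a = 0 →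
      HasSymmetry u a 0 A → VanishesOnPast u

/-- **Rotated-self-similar Liouville with BOUNDED profile** (`σ = 1`, `A ≠ 0` skew, `a = 0`):
OPEN in print. Precisely: the temporal Type-I bound of `𝒜_C` only makes the profile `U` BOUNDED;
Pineau–Vicol (arXiv:2607.09619) Thm 1.4 = in-tree named fact `pineauVicol2026_rss_liouville`
(`PineauVicolRSS.lean`) assumes the SPACE-TIME bound `‖u‖ ≤ C₀/(‖x‖ + √(−t))` (1.10), i.e. a profile
decaying like `1/|y|`, and then needs `|α| < α₁(C₀)` or `|α| > α₂(C₀)`; so for bounded non-decaying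
profiles EVERY `α ≠ 0` is open, and for decaying profiles `α ~ 1` is open (their Conj. 1.1 = Tsai
2018 Conj. 8.9). (`A = 0` is Tsai 1998 Thm 1 with `q = ∞`, in tree as the theorem
`tsai_selfsimilar_bounded_holds`: a bounded Leray profile is constant, hence `0` in the gauge.) -/
def RotatedSelfSimilarLiouville : Prop :=
  ∀ (C : ℝ) (u : ℝ → E3 → E3), InClass C u →
    ∀ (A : E3 →L[ℝ] E3), IsSkew A → A ≠ 0 → HasSymmetry u 0 1 A → VanishesOnPast u

/-- **The residual open core** (where a counterexample to the crux would have to live, §(c)):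
rotated-self-similar Liouville for profiles with the SPACE-TIME Type-I bound
`‖u(t,x)‖ ≤ C₀/(‖x‖ + √(−t))` (in-tree `HasTypeIDecay`, = Pineau–Vicol (1.10), i.e. a profile
decaying like `1/|y|`), at EVERY rotation rate `A ≠ 0`: Pineau–Vicol Conj. 1.1 = Tsai 2018
Conj. 8.9 (Perelman). PV Thm 1.4 (in-tree fact `pineauVicol2026_rss_liouville`) gives it for
`|α| < α₁(C₀)` and `|α| > α₂(C₀)` only. -/
def RotatedSelfSimilarLiouvilleDecaying : Prop :=
  ∀ (C C₀ : ℝ) (u : ℝ → E3 → E3), InClass C u → HasTypeIDecay C₀ u →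
    ∀ (A : E3 →L[ℝ] E3), IsSkew A → A ≠ 0 → HasSymmetry u 0 1 A → VanishesOnPast u

/-- The bounded-profile RSS statement implies the decaying-profile one (more hypotheses). -/
theorem rss_implies_rss_decaying : RotatedSelfSimilarLiouville → RotatedSelfSimilarLiouvilleDecaying :=
  fun h C _ u hu _ A hA hA0 hsym => h C u hu A hA hA0 hsym

/-- The crux implies the open helical Liouville statement (specialisation `σ = 0`). -/
theorem symmetricLiouville_implies_helical : SymmetricLiouville → HelicalTypeILiouville := by
  intro h C u hu a A hA hA0 _ha0 _haxis hsym
  exact h C u hu a 0 A hA (fun hz => hA0 hz.2.2) hsym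

/-- The crux implies the open rotated-self-similar (bounded profile) Liouville statement
(specialisation `a = 0`, `σ = 1`). -/
theorem symmetricLiouville_implies_rss : SymmetricLiouville → RotatedSelfSimilarLiouville := by
  intro h C u hu A hA _hA0 hsym
  exact h C u hu 0 1 A hA (fun hz => one_ne_zero hz.2.1) hsym

/-- Hence the crux implies Perelman–Tsai–Pineau–Vicol's conjecture in the gauge class: a negative
resolution of PV Conj. 1.1 at some `α ~ 1` (a nonzero backward RSS solution with space-time Type-I
profile which is KNSS-mild) would refute the crux, the target `X`, and the route. -/
theorem symmetricLiouville_implies_rss_decaying :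
    SymmetricLiouville → RotatedSelfSimilarLiouvilleDecaying :=
  fun h => rss_implies_rss_decaying (symmetricLiouville_implies_rss h)

/-! ## (d) Cycle 2 (gen-2 seat): the nonlinearity is load-bearing; the symmetry clause is
un-witnessable; `IsSkew` shields nothing

Everything in this section is also filed for `Theorems/SymmetricLiouville/Negative/NonlinearLoadBearing.lean`.
-/

/-- **Bridge (definitional)**: `𝒜_C` of the crux is the tree's
`Literature.Analysis.FluidPDE.IsTypeIAncientMild C` (`TypeIAncientMild.lean`; `oseenDuhamel 1 s u u t x`
unfolds to the literal double integral of the route). Hence its API applies verbatim: time shifts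
into the past (`comp_sub_right`), KNSS Rem. 6.1 (`eq_zero_of_slice_const`), the duality-form bridge
(`isAncientMildSolution`, `isBoundedAncientMildSolution_sub`), classical-solution extraction
(`TypeIAncientMildClassical.lean`). -/
theorem inClass_iff_isTypeIAncientMild {C : ℝ} {u : ℝ → E3 → E3} :
    InClass C u ↔ IsTypeIAncientMild C u := by
  rw [isTypeIAncientMild_iff]
  rfl

/-- The class is invariant under time shifts into the past (`t ↦ u(t − δ)`, `δ ≥ 0`). (The
time-shifted copy of a scaling-symmetric element carries the generator `x·∇ + 1 + 2(t−δ)∂ₜ`, which is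
NOT in the crux's family `sim(3)` anchored at `t = 0` — harmless for 4053, see §(c) SCOPE REMARK.) -/
theorem InClass.timeShift {C : ℝ} {u : ℝ → E3 → E3} (hu : InClass C u) {δ : ℝ} (hδ : 0 ≤ δ) :
    InClass C (fun t => u (t - δ)) :=
  inClass_iff_isTypeIAncientMild.2 ((inClass_iff_isTypeIAncientMild.1 hu).comp_sub_right hδ)

/-- **No parasitic moduli in `𝒜_C`** (KNSS 2009 Rem. 6.1 + the decay; tree
`IsTypeIAncientMild.eq_zero_of_slice_const`): a slice-wise spatially constant element
`u(t,·) = b(t)` of `𝒜_C` is `0`, with no symmetry hypothesis at all. -/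
theorem InClass.vanishes_of_slice_const {C : ℝ} {u : ℝ → E3 → E3} (hu : InClass C u)
    {b : ℝ → E3} (hub : ∀ t < 0, ∀ x, u t x = b t) : VanishesOnPast u :=
  fun _ ht x => (inClass_iff_isTypeIAncientMild.1 hu).eq_zero_of_slice_const hub ht x

/-! ### The linearised crux is trivially true -/

/-- A vector with `‖v‖ ≤ C/√(−s)` for all `s` below some `t ≤ 0` is zero (`s → −∞`). -/
theorem eq_zero_of_forall_norm_le_div_sqrt {v : E3} {t C : ℝ}
    (h : ∀ s < t, ‖v‖ ≤ C / Real.sqrt (-s)) (ht : t ≤ 0) : v = 0 := by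
  by_contra hv
  have hn : 0 < ‖v‖ := norm_pos_iff.2 hv
  set s : ℝ := t - (C / ‖v‖) ^ 2 - 1 with hs
  have hst : s < t := by rw [hs]; nlinarith [sq_nonneg (C / ‖v‖)]
  have hneg : (C / ‖v‖) ^ 2 < -s := by rw [hs]; linarith
  have hspos : 0 < Real.sqrt (-s) := Real.sqrt_pos.2 (by nlinarith [sq_nonneg (C / ‖v‖)])
  have h1 : |C| / ‖v‖ < Real.sqrt (-s) := by
    rw [← abs_of_pos hn, ← abs_div, ← Real.sqrt_sq_eq_abs]
    exact Real.sqrt_lt_sqrt (sq_nonneg _) hneg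
  have h2 : |C| < Real.sqrt (-s) * ‖v‖ := by rwa [div_lt_iff₀ hn] at h1
  have h3 : ‖v‖ * Real.sqrt (-s) ≤ C := (le_div_iff₀ hspos).1 (h s hst)
  linarith [le_abs_self C, mul_comm ‖v‖ (Real.sqrt (-s))]

/-- **Linear Liouville — the nonlinearity is load-bearing for any counterexample.** A field on
`(−∞,0) × ℝ³` propagated by the heat semigroup between all times `s < t < 0` with the Type-I time
bound vanishes: `‖u(t,x)‖ = ‖e^{(t−s)Δ}u(s)(x)‖ ≤ C/√(−s) → 0` as `s → −∞`
(`norm_heatExtension_le_of_bound`). No smoothness, divergence, measurability or SYMMETRY is used: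
at the linear level the crux is true for free, so the would-be counterexample lives entirely in the
large-`C` nonlinear regime (`√(−t)‖u(t)‖_∞ ≤ c·C²` forces `C ≥ 1/c`, the perturbative threshold). -/
theorem vanishes_of_heatMild_typeI {C : ℝ} {u : ℝ → E3 → E3}
    (hheat : ∀ s t : ℝ, s < t → t < 0 → ∀ x, u t x = heatFlow (u s) (t - s) x)
    (hT : HasTypeITimeDecay C u) : VanishesOnPast u := by
  intro t ht x
  refine eq_zero_of_forall_norm_le_div_sqrt (t := t) (C := C) (fun s hs => ?_) ht.le
  have hσ : 0 < t - s := sub_pos.2 hs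
  rw [hheat s t hs ht x, heatFlow_of_pos _ hσ]
  exact Literature.Analysis.UnboundedOperators.norm_heatExtension_le_of_bound
    (fun z => hT s (hs.trans ht) z) hσ x

/-- **An element of `𝒜_C` whose Oseen–Duhamel term vanishes identically is `0`** (no symmetry
needed). Kills inside `𝒜_C`, in one stroke, every explicit family with vanishing or pure-gradient
nonlinearity: constants, parallel / shear flows (`shearWave`), Beltrami–Trkalian modes `e^{−λ²t}U`
(`(U·∇)U = ∇|U|²/2`), all of which are exact Navier–Stokes solutions. -/
theorem InClass.vanishes_of_duhamel_zero {C : ℝ} {u : ℝ → E3 → E3} (hu : InClass C u)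
    (hD : ∀ s t : ℝ, s < t → t < 0 → ∀ x,
      ∫ τ in Set.Ioo s t, ∫ y, oseenKernel (t - τ) (x - y) (u τ y) (u τ y) = 0) :
    VanishesOnPast u := by
  refine vanishes_of_heatMild_typeI (C := C) (fun s t hst ht x => ?_) hu.2.2.2
  rw [hu.2.2.1 s t hst ht x, hD s t hst ht x, sub_zero]

/-- **The Duhamel integral from the far past carries all of `u`**: for `u ∈ 𝒜_C` and `s < t < 0`,
`‖u(t,x)‖ ≤ C/√(−s) + ‖∫_s^t ∫ K(t−τ, x−y)[u(τ,y), u(τ,y)] dy dτ‖`, the first term being `o(1)` as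
`s → −∞`. With Koch–Tataru's bound (14) the second term is `≤ c ∫_s^t (t−τ)^{-1/2} C²/(−τ) dτ ≤ cπC²/√(−t)`:
the crux is trivially true for `C < 1/(cπ)` and any counterexample saturates this balance. -/
theorem InClass.norm_le_div_sqrt_add_norm_duhamel {C : ℝ} {u : ℝ → E3 → E3} (hu : InClass C u)
    {s t : ℝ} (hst : s < t) (ht : t < 0) (x : E3) :
    ‖u t x‖ ≤ C / Real.sqrt (-s) +
      ‖∫ τ in Set.Ioo s t, ∫ y, oseenKernel (t - τ) (x - y) (u τ y) (u τ y)‖ := by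
  have hσ : 0 < t - s := sub_pos.2 hst
  rw [hu.2.2.1 s t hst ht x, heatFlow_of_pos _ hσ]
  exact (norm_sub_le _ _).trans (add_le_add
    (Literature.Analysis.UnboundedOperators.norm_heatExtension_le_of_bound
      (fun z => hu.2.2.2 s (hst.trans ht) z) hσ x) le_rfl)

/-! ### Quantitative: the gap theorem — small scale-invariant size forces `u = 0` -/

/-- **Gap theorem for `𝒜_C` (perturbative regime; no symmetry).** There is an absolute `ε₀ > 0`
such that every element of `𝒜_C` (any `C`) with `√(−t)‖u(t,x)‖ ≤ ε₀` for all `t < 0` and `x`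
vanishes identically. Proof as in Chae–Wolf 2017, Step 1 (tree:
`ChaeWolf.exists_eps_typeI_small_eq_zero`, stated there for classical solutions with the SPACE–TIME
bound; here mildness is a hypothesis of the class, so neither KNSS Thm 6.1 nor spatial decay is
needed): the Oseen identity from `4t` to `t`, the heat contraction and Koch–Tataru's kernel bound
(14) (`exists_norm_oseenKernel_le`, `ChaeWolf.norm_integral_oseenKernel_le`) give
`B ≤ B/2 + K₀B²` for `B = sup √(−t)‖u‖`, hence `B = 0` once `K₀B ≤ 1/4`.
CONSEQUENCES: (i) the crux AND the route target `X` hold outright in the regime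
`sup √(−t)‖u‖ ≤ ε₀`, in particular for `C ≤ ε₀` (`exists_eps_vanishes_of_le`); (ii) every
counterexample to the crux has scale-invariant size `> ε₀` at some point — with
`vanishes_of_duhamel_zero` this pins it in the genuinely nonlinear, non-perturbative regime;
(iii) the ideators' stub "small at `−∞` ⇒ `0`" is this lemma run on `(−∞, T]` plus forward
uniqueness of bounded Oseen-mild solutions (tree: `oseenMild_bounded_unique`). -/
theorem exists_eps_small_vanishes :
    ∃ ε₀ : ℝ, 0 < ε₀ ∧ ∀ (C : ℝ) (u : ℝ → E3 → E3), InClass C u →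
      (∀ t < 0, ∀ x, Real.sqrt (-t) * ‖u t x‖ ≤ ε₀) → VanishesOnPast u := by
  obtain ⟨K, hK, hKb⟩ := exists_norm_oseenKernel_le (E := E3)
  set M₀ : ℝ := ∫ w : E3, (1 + ‖w‖ ^ 2) ^ (-(2 : ℝ)) with hM₀
  have hM₀0 : 0 ≤ M₀ := integral_nonneg fun w => Real.rpow_nonneg (by positivity) _
  set K₀ : ℝ := 4 * K * M₀ with hK₀
  have hK₀0 : 0 ≤ K₀ := by positivity
  set ε : ℝ := 1 / (4 * K₀ + 4) with hε
  have hε0 : 0 < ε := by positivity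
  have hKε : K₀ * ε ≤ 1 / 4 := by
    rw [hε, mul_one_div, div_le_iff₀ (by positivity)]
    linarith
  refine ⟨ε, hε0, ?_⟩
  intro C u hu hsmall
  have finrank_R3_real : ((Module.finrank ℝ E3 : ℕ) : ℝ) = 3 := by simp
  have hK' : ∀ {τ : ℝ}, 0 < τ → ∀ z a b : E3,
      ‖oseenKernel τ z a b‖ ≤ K * (τ + ‖z‖ ^ 2) ^ (-(2 : ℝ)) * ‖a‖ * ‖b‖ := by
    intro τ hτ z a b
    have h := hKb hτ z a b
    rw [finrank_R3_real, show (-(((3 : ℝ) + 1) / 2)) = -(2 : ℝ) by norm_num] at h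
    exact h
  set S : Set ℝ := {r | ∃ t : ℝ, t < 0 ∧ ∃ x : E3, r = Real.sqrt (-t) * ‖u t x‖} with hS
  have hSb : BddAbove S := ⟨ε, by rintro r ⟨t, ht, x, rfl⟩; exact hsmall t ht x⟩
  have hSn : S.Nonempty := ⟨_, -1, by norm_num, 0, rfl⟩
  set B : ℝ := sSup S with hB
  have hqB : ∀ t < 0, ∀ x, Real.sqrt (-t) * ‖u t x‖ ≤ B := fun t ht x =>
    le_csSup hSb ⟨t, ht, x, rfl⟩
  have hBε : B ≤ ε := csSup_le hSn (by rintro r ⟨t, ht, x, rfl⟩; exact hsmall t ht x)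
  have hB0 : 0 ≤ B := le_trans (by positivity) (hqB (-1) (by norm_num) 0)
  have hptw : ∀ σ < 0, ∀ y, ‖u σ y‖ ≤ B / Real.sqrt (-σ) := by
    intro σ hσ y
    have hs : 0 < Real.sqrt (-σ) := Real.sqrt_pos.2 (by linarith)
    rw [le_div_iff₀ hs, mul_comm]
    exact hqB σ hσ y
  -- the key estimate `√(-t) ‖u(t, x)‖ ≤ B/2 + K₀ B²`
  have hkey : ∀ t < 0, ∀ x, Real.sqrt (-t) * ‖u t x‖ ≤ B / 2 + K₀ * B ^ 2 := by
    intro t ht x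
    set r : ℝ := Real.sqrt (-t) with hr
    have hr0 : 0 < r := Real.sqrt_pos.2 (by linarith)
    have hr2 : r ^ 2 = -t := Real.sq_sqrt (by linarith)
    -- the Oseen identity of the class between `4t` and `t`
    have hmild : u t x =
        Literature.Analysis.UnboundedOperators.heatExtension (u (4 * t)) (t - 4 * t) x -
          oseenDuhamel 1 (4 * t) u u t x := by
      have h1 := hu.2.2.1 (4 * t) t (by linarith) ht x
      rw [heatFlow_of_pos _ (by linarith)] at h1
      simpa only [oseenDuhamel, one_mul] using h1
    -- the caloric term
    have hheat :
        ‖Literature.Analysis.UnboundedOperators.heatExtension (u (4 * t)) (t - 4 * t) x‖ ≤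
          B / (2 * r) := by
      have hb : ∀ z, ‖u (4 * t) z‖ ≤ B / (2 * r) := by
        intro z
        have := hptw (4 * t) (by linarith) z
        rwa [ChaeWolf.sqrt_neg_four_mul, ← hr] at this
      exact Literature.Analysis.UnboundedOperators.norm_heatExtension_le_of_bound hb (by linarith) x
    -- the Duhamel term
    have hduh : ‖oseenDuhamel 1 (4 * t) u u t x‖ ≤ K₀ * B ^ 2 / r := by
      rw [oseenDuhamel_apply]
      have hG : IntegrableOn (fun σ : ℝ => K * M₀ * (B ^ 2 / r ^ 2) * (t - σ) ^ (-(1 / 2 : ℝ)))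
          (Set.Ioo (4 * t) t) := (ChaeWolf.integrableOn_rpow_sub ht).const_mul _
      have hpt : ∀ᵐ σ ∂(volume.restrict (Set.Ioo (4 * t) t)),
          ‖∫ y, oseenKernel (1 * (t - σ)) (x - y) (u σ y) (u σ y)‖ ≤
            K * M₀ * (B ^ 2 / r ^ 2) * (t - σ) ^ (-(1 / 2 : ℝ)) := by
        refine ae_restrict_of_forall_mem measurableSet_Ioo fun σ hσ => ?_
        have hσ0 : σ < 0 := hσ.2.trans ht
        have hτ : 0 < 1 * (t - σ) := by linarith [hσ.2]
        have h1 := ChaeWolf.norm_integral_oseenKernel_le hK' hK.le hτ x (hptw σ hσ0)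
        rw [one_mul] at h1 ⊢
        refine h1.trans ?_
        have hsq : (B / Real.sqrt (-σ)) ^ 2 = B ^ 2 / (-σ) := by
          rw [div_pow, Real.sq_sqrt (by linarith)]
        rw [hsq]
        have hw0 : 0 ≤ (t - σ) ^ (-(1 / 2 : ℝ)) := Real.rpow_nonneg (by linarith [hσ.2]) _
        have hfrac : B ^ 2 / (-σ) ≤ B ^ 2 / r ^ 2 := by
          rw [hr2]
          exact div_le_div_of_nonneg_left (sq_nonneg B) (by linarith) (by linarith [hσ.2])
        calc K * M₀ * (t - σ) ^ (-(1 / 2 : ℝ)) * (B ^ 2 / -σ)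
            ≤ K * M₀ * (t - σ) ^ (-(1 / 2 : ℝ)) * (B ^ 2 / r ^ 2) := by gcongr
          _ = K * M₀ * (B ^ 2 / r ^ 2) * (t - σ) ^ (-(1 / 2 : ℝ)) := by ring
      refine (norm_integral_le_of_norm_le hG hpt).trans ?_
      rw [MeasureTheory.integral_const_mul, ChaeWolf.integral_rpow_sub ht]
      have h3 := ChaeWolf.sqrt_neg_three_mul_le t ht
      rw [← hr] at h3
      have hrr : r ^ 2 = r * r := sq r
      calc K * M₀ * (B ^ 2 / r ^ 2) * (2 * Real.sqrt (-(3 * t)))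
          ≤ K * M₀ * (B ^ 2 / r ^ 2) * (2 * (2 * r)) := by gcongr
        _ = K₀ * B ^ 2 / r := by
            rw [hK₀, hrr]
            field_simp
            ring
    -- assemble
    have hnorm : ‖u t x‖ ≤ B / (2 * r) + K₀ * B ^ 2 / r := by
      rw [hmild]
      exact (norm_sub_le _ _).trans (add_le_add hheat hduh)
    calc r * ‖u t x‖ ≤ r * (B / (2 * r) + K₀ * B ^ 2 / r) := by gcongr
      _ = B / 2 + K₀ * B ^ 2 := by field_simp
  -- bootstrap: `B ≤ B/2 + K₀ B²` and `B ≤ ε` force `B = 0`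
  have hB1 : B ≤ B / 2 + K₀ * B ^ 2 :=
    csSup_le hSn (by rintro r ⟨t, ht, x, rfl⟩; exact hkey t ht x)
  have hB2 : K₀ * B ^ 2 ≤ B / 4 := by
    calc K₀ * B ^ 2 = (K₀ * B) * B := by ring
      _ ≤ (K₀ * ε) * B := by gcongr
      _ ≤ (1 / 4) * B := by gcongr
      _ = B / 4 := by ring
  have hB00 : B ≤ 0 := by linarith
  intro t ht x
  have hst : 0 < Real.sqrt (-t) := Real.sqrt_pos.2 (by linarith)
  have h' : Real.sqrt (-t) * ‖u t x‖ ≤ 0 := (hqB t ht x).trans hB00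
  have hn : ‖u t x‖ ≤ 0 := by
    by_contra hcon
    have hcon' : 0 < ‖u t x‖ := lt_of_not_ge hcon
    have : 0 < Real.sqrt (-t) * ‖u t x‖ := mul_pos hst hcon'
    linarith
  exact norm_le_zero_iff.1 hn

/-- **The small-`C` regime is empty of counterexamples**: the crux — indeed the route target `X`,
with no symmetry — holds for every `C ≤ ε₀` (`√(−t)‖u(t,x)‖ ≤ C`). Any counterexample lives at
`C > ε₀`, an absolute constant (Koch–Tataru's kernel constant in dimension three). -/
theorem exists_eps_vanishes_of_le :
    ∃ ε₀ : ℝ, 0 < ε₀ ∧ ∀ (C : ℝ) (u : ℝ → E3 → E3), InClass C u → C ≤ ε₀ → VanishesOnPast u := by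
  obtain ⟨ε₀, hε₀, h⟩ := exists_eps_small_vanishes
  refine ⟨ε₀, hε₀, fun C u hu hC => h C u hu fun t ht x => ?_⟩
  have hs : 0 < Real.sqrt (-t) := Real.sqrt_pos.2 (by linarith)
  calc Real.sqrt (-t) * ‖u t x‖ ≤ Real.sqrt (-t) * (C / Real.sqrt (-t)) := by
        gcongr
        exact hu.2.2.2 t ht x
    _ = C := by field_simp
    _ ≤ ε₀ := hC

/-! ### The symmetry clause is un-witnessable: every kill exhibits `𝒜_C ∖ {0} ≠ ∅` -/

/-- **Any refutation of the crux produces a nonzero Type-I ancient mild solution** carrying a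
nonzero infinitesimal similarity symmetry (unfolding the negation through `symmetricLiouville_iff`).
Since the only known element of `𝒜_C` is `0` — a nonzero one is (the profile of) a Type-I
singularity — NO mutation of the symmetry clause (dropping `IsSkew`, dropping the non-triviality of
`ξ`, assuming the symmetry on a window only, …) can be shown load-bearing by an example: every such
witness is a nonzero element of `𝒜_C`. Only the four CLASS hypotheses admit mutation witnesses
(§(a), §(a′)). -/
theorem exists_witness_of_not_symmetricLiouville (h : ¬ SymmetricLiouville) :
    ∃ (C : ℝ) (u : ℝ → E3 → E3), InClass C u ∧
      (∃ (a : E3) (σ : ℝ) (A : E3 →L[ℝ] E3), IsSkew A ∧ ¬ (a = 0 ∧ σ = 0 ∧ A = 0) ∧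
        HasSymmetry u a σ A) ∧ ∃ t < 0, ∃ x, u t x ≠ 0 := by
  by_contra hcon
  apply h
  rw [symmetricLiouville_iff]
  intro C u hu a σ A hA hne hsym t ht x
  by_contra hx
  exact hcon ⟨C, u, hu, ⟨a, σ, A, hA, hne, hsym⟩, t, ht, x, hx⟩

/-- **A kill of the crux kills the route target `X`** (contrapositive of
`symmetricLiouville_of_typeIAncientLiouville`): the disprover's only possible product is a nonzero
Type-I ancient mild solution, i.e. (Seregin–Šverák 2009, Albritton–Barker 2019) a Type-I singularity
of Navier–Stokes — here one with a continuous similarity symmetry. -/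
theorem not_typeIAncientLiouville_of_not_symmetricLiouville (h : ¬ SymmetricLiouville) :
    ¬ TypeIAncientLiouville :=
  fun hX => h (symmetricLiouville_of_typeIAncientLiouville hX)

/-! ## (e) `IsSkew` shields nothing: the two simplest non-skew generators are harmless

The previous cycle conjectured that `IsSkew` is unnecessary. Two kernel-checked instances: the
pure dilation `A = 1` (killed by BOUNDEDNESS of a slice — Euler's homogeneous-function theorem) and
the anti-scaling `ξ = (0, σ, −σ·1)` (killed by the Type-I RATE at `t → 0⁻`). The remaining non-skew
directions reduce on paper to the same mechanisms (an eigenvalue with nonzero real part ⇒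
boundedness along the expanding/contracting orbit; nilpotent ⇒ shear-invariance ⇒ 2.5-D ⇒ leaf (T)),
except the "elliptic rotations" (semisimple, spectrum `{0, ±iω}`, non-normal), for which no
reduction and no example is known — but by §(d) no example can exist short of a nonzero element of
`𝒜_C` anyway. -/

/-- **Euler's theorem, bounded case**: a differentiable field with `Du(x)·x = u(x)` for all `x`
(homogeneous of degree one) which is bounded vanishes identically: `s ↦ e^{−s}u(e^{s}x)` has
derivative `0`, so `‖u(x)‖ e^{s} = ‖u(e^{s}x)‖ ≤ M` for every `s`. -/
theorem eq_zero_of_fderiv_self_of_bounded {v : E3 → E3} (hv : Differentiable ℝ v)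
    (hE : ∀ x, fderiv ℝ v x x = v x) {M : ℝ} (hM : ∀ x, ‖v x‖ ≤ M) (x : E3) : v x = 0 := by
  set g : ℝ → E3 := fun s => Real.exp (-s) • v (Real.exp s • x) with hg
  have hderiv : ∀ s, HasDerivAt g 0 s := by
    intro s
    have h1 : HasDerivAt (fun r => Real.exp r • x) (Real.exp s • x) s :=
      (Real.hasDerivAt_exp s).smul_const x
    have h2 : HasDerivAt (fun r => v (Real.exp r • x))
        (fderiv ℝ v (Real.exp s • x) (Real.exp s • x)) s :=
      (hv (Real.exp s • x)).hasFDerivAt.comp_hasDerivAt s h1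
    rw [hE] at h2
    have h3 : HasDerivAt (fun r => Real.exp (-r)) (-Real.exp (-s)) s := by
      have h := ((hasDerivAt_id s).neg).exp
      simp only [mul_neg, mul_one] at h
      exact h
    have h4 : HasDerivAt g
        (Real.exp (-s) • v (Real.exp s • x) + (-Real.exp (-s)) • v (Real.exp s • x)) s :=
      h3.fun_smul h2
    have hz : Real.exp (-s) • v (Real.exp s • x) + (-Real.exp (-s)) • v (Real.exp s • x) = 0 := by
      rw [neg_smul, add_neg_cancel]
    rwa [hz] at h4
  have hconst : ∀ s, g s = g 0 := fun s =>
    is_const_of_deriv_eq_zero (fun s => (hderiv s).differentiableAt) (fun s => (hderiv s).deriv) s 0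
  have hg0 : g 0 = v x := by simp [hg]
  have hbound : ∀ s : ℝ, ‖v x‖ * Real.exp s ≤ M := by
    intro s
    have h := hconst s
    rw [hg0] at h
    simp only [hg] at h
    rw [← h, norm_smul, Real.norm_eq_abs, abs_of_pos (Real.exp_pos _), mul_comm,
      ← mul_assoc, ← Real.exp_add, add_neg_cancel, Real.exp_zero, one_mul]
    exact hM _
  by_contra hx
  have hn : 0 < ‖v x‖ := norm_pos_iff.2 hx
  have h1 := hbound (M / ‖v x‖)
  have h2 : M / ‖v x‖ + 1 ≤ Real.exp (M / ‖v x‖) := Real.add_one_le_exp _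
  have h3 : ‖v x‖ * (M / ‖v x‖ + 1) ≤ M := (mul_le_mul_of_nonneg_left h2 hn.le).trans h1
  rw [mul_add, mul_div_cancel₀ _ hn.ne', mul_one] at h3
  linarith

/-- **`IsSkew` shields nothing in the direction `A = 1`** (`ξ = (0, 0, 1)`, NOT skew): the symmetry
clause reads `(x·∇)u = u` on every slice; a slice of an element of `𝒜_C` is smooth and bounded by
`C/√(−t)`, hence `0` by Euler's theorem. The non-skew mutant of the crux HOLDS at this `ξ`. -/
theorem vanishes_of_hasSymmetry_id {C : ℝ} {u : ℝ → E3 → E3} (hu : InClass C u)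
    (h : HasSymmetry u 0 0 (ContinuousLinearMap.id ℝ E3)) : VanishesOnPast u := by
  intro t ht x
  have hcl := inClass_iff_isTypeIAncientMild.1 hu
  have hdiff : Differentiable ℝ (u t) := (hcl.contDiff_slice ht).differentiable (by simp)
  have hE : ∀ y, fderiv ℝ (u t) y y = u t y := by
    intro y
    have := h t ht y
    simp only [zero_smul, zero_add, ContinuousLinearMap.id_apply, mul_zero, zero_mul,
      add_zero, sub_eq_zero] at this
    exact this
  exact eq_zero_of_fderiv_self_of_bounded hdiff hE (fun y => hcl.norm_le ht y) x

/-- **`IsSkew` shields nothing in the direction `A = −σ·1`** (`ξ = (0, σ, −σ·1)`, `σ ≠ 0`, NOT skew):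
the spatial parts cancel and the clause reads `2σ(u + t∂ₜu) = 0`, so `t ↦ t·u(t,x)` is constant on
`(−∞,0)`, `u(t,x) = U(x)/(−t)`; the Type-I RATE near `t = 0⁻` gives `‖U(x)‖ ≤ C√(−t') → 0`.
Dually to `FinerCuts.lean` (decay at `−∞`), here it is the rate at `0⁻` that is used. -/
theorem vanishes_of_hasSymmetry_antiscaling {C : ℝ} {u : ℝ → E3 → E3} (hu : InClass C u)
    {σ : ℝ} (hσ : σ ≠ 0) (h : HasSymmetry u 0 σ (-(σ • ContinuousLinearMap.id ℝ E3))) :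
    VanishesOnPast u := by
  have hcl := inClass_iff_isTypeIAncientMild.1 hu
  have hC : 0 ≤ C := hcl.nonneg
  intro t ht x
  set f : ℝ → E3 := fun r => u r x with hf
  have hfd : ∀ r < 0, DifferentiableAt ℝ f r := by
    intro r hr
    have h1 : ContDiffAt ℝ (⊤ : ℕ∞) (Function.uncurry u) (r, x) :=
      hu.1.contDiffAt ((isOpen_Iio.prod isOpen_univ).mem_nhds ⟨hr, Set.mem_univ _⟩)
    have h2 : ContDiffAt ℝ (⊤ : ℕ∞) (fun r' : ℝ => (r', x)) r :=
      (contDiff_id.prodMk contDiff_const).contDiffAt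
    exact (h1.comp r h2).differentiableAt (by simp)
  have hode : ∀ r < 0, f r + r • deriv f r = 0 := by
    intro r hr
    have key := h r hr x
    have hsp : (0 : E3) + σ • x + (-(σ • ContinuousLinearMap.id ℝ E3)) x = 0 := by simp
    rw [hsp, map_zero, zero_add] at key
    have e : (-(σ • ContinuousLinearMap.id ℝ E3)) (u r x) = -(σ • u r x) := rfl
    rw [e] at key
    simp only [sub_neg_eq_add, timeDeriv_apply] at key
    have key2 : (2 * σ) • (f r + r • deriv f r) = 0 := by
      rw [← key, hf]
      module
    rcases smul_eq_zero.1 key2 with h0 | h0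
    · exact absurd h0 (mul_ne_zero two_ne_zero hσ)
    · exact h0
  set F : ℝ → E3 := fun r => r • f r with hF
  have hFd : ∀ r < 0, HasDerivAt F 0 r := by
    intro r hr
    have h1 : HasDerivAt F (id r • deriv f r + (1 : ℝ) • f r) r :=
      (hasDerivAt_id r).fun_smul (hfd r hr).hasDerivAt
    simp only [id, one_smul] at h1
    rwa [add_comm, hode r hr] at h1
  have hFconst : ∀ r < 0, F r = F t := by
    intro r hr
    exact IsOpen.is_const_of_deriv_eq_zero isOpen_Iio isPreconnected_Iio
      (fun r' hr' => (hFd r' hr').differentiableAt.differentiableWithinAt)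
      (fun r' hr' => (hFd r' hr').deriv) hr ht
  have hbound : ∀ r < 0, ‖u t x‖ ≤ C * Real.sqrt (-r) / (-t) := by
    intro r hr
    have h1 : t • u t x = r • u r x := (hFconst r hr).symm
    have hsr : 0 < Real.sqrt (-r) := Real.sqrt_pos.2 (by linarith)
    have h2 : ‖u r x‖ ≤ C / Real.sqrt (-r) := hcl.norm_le hr x
    have h3 : (-t) * ‖u t x‖ = (-r) * ‖u r x‖ := by
      have := congrArg (fun v => ‖v‖) h1
      simp only [norm_smul, Real.norm_eq_abs, abs_of_neg ht, abs_of_neg hr] at this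
      exact this
    rw [le_div_iff₀ (by linarith : (0:ℝ) < -t), mul_comm, h3]
    calc (-r) * ‖u r x‖ ≤ (-r) * (C / Real.sqrt (-r)) := by gcongr; linarith
      _ = C * Real.sqrt (-r) := by
          rw [mul_div_assoc', div_eq_iff hsr.ne', mul_assoc, Real.mul_self_sqrt (by linarith)]
          ring
  by_contra hx
  have hn : 0 < ‖u t x‖ := norm_pos_iff.2 hx
  set ε : ℝ := ‖u t x‖ * (-t) / (2 * (C + 1)) with hε
  have hε0 : 0 < ε := by
    rw [hε]
    exact div_pos (mul_pos hn (by linarith)) (by linarith)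
  have h1 := hbound (-(ε ^ 2)) (by have := pow_pos hε0 2; linarith)
  rw [neg_neg, Real.sqrt_sq hε0.le] at h1
  have h2 : C * ε / (-t) < ‖u t x‖ := by
    rw [div_lt_iff₀ (by linarith : (0:ℝ) < -t), hε]
    have : C * (‖u t x‖ * -t / (2 * (C + 1))) = (C / (C + 1)) * (‖u t x‖ * -t) / 2 := by
      field_simp
    rw [this]
    have hc1 : C / (C + 1) < 1 := (div_lt_one (by linarith)).2 (by linarith)
    have hpos : 0 < ‖u t x‖ * -t := mul_pos hn (by linarith)
    nlinarith
  linarith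

/-! ## (f) Cycle 2: the screw clause integrates (audit item (iii) made formal)

The crux states its symmetry infinitesimally (`L_ξ u = 0`), the ideators' stubs use the finite forms
(`IsAxisymmetric`, `2πh`-periodicity along the axis). The bridge is an ODE fact with no
Navier–Stokes content; it is recorded here kernel-checked so that `HelicalIsPeriodic`,
`periodic_of_screw` and the `IsAxisymmetric` hypotheses of the axis stubs are known to be faithful
to the crux. Proof: `w(θ) = u(R_θ x + θh e_z) − R_θ u(x)` solves `w' = Jw`, `w(0) = 0`, and `J` is
skew, so `‖w‖²` is constant. -/

/-- The axial unit vector `e_z`. -/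
def ez : E3 := EuclideanSpace.single 2 1

/-- `J e_z = 0`. -/
theorem rotGen_ez : rotGen ez = 0 := rotGen_single_two

/-- `⟪J v, v⟫ = 0`: the rotation generator is skew (so `rotGenL` satisfies `IsSkew`). -/
theorem inner_rotGen_self (v : E3) : ⟪rotGen v, v⟫ = 0 := by
  rw [inner_rotGen_left]; ring

/-- `rotGenL` satisfies the crux's `IsSkew`. -/
theorem isSkew_rotGenL : IsSkew rotGenL := fun v => by
  rw [rotGenL_apply]; exact inner_rotGen_self v

/-- The velocity of `θ ↦ R_θ x` is `J (R_θ x)` (the tree's `hasDerivAt_rotZ`, rewritten). -/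
theorem hasDerivAt_rotZ_rotGen (x : E3) (θ : ℝ) :
    HasDerivAt (fun φ => rotZ φ x) (rotGen (rotZ θ x)) θ := by
  have h := hasDerivAt_rotZ x θ
  have e : -Real.sin θ • (WithLp.toLp 2 ![x 0, x 1, 0] : E3) + Real.cos θ • rotGen x =
      rotGen (rotZ θ x) := by
    ext i
    fin_cases i <;> simp [rotGen] <;> ring
  rwa [e] at h

/-- **Integrating the screw clause.** If a differentiable field satisfies
`Du(y)[h e_z + J y] = J u(y)` for all `y` — the crux's clause for `ξ = (h e_z, 0, J)`, a screw motion
of pitch `h` about the `z`-axis (`h = 0`: a rotation) — then `u(R_θ x + θh e_z) = R_θ u(x)` for every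
`θ` and `x`. -/
theorem screw_equivariant {u : E3 → E3} (hu : Differentiable ℝ u) (h : ℝ)
    (hcl : ∀ y, fderiv ℝ u y (h • ez + rotGen y) = rotGen (u y)) (θ : ℝ) (x : E3) :
    u (rotZ θ x + (θ * h) • ez) = rotZ θ (u x) := by
  -- the orbit and its velocity
  set γ : ℝ → E3 := fun φ => rotZ φ x + (φ * h) • ez with hγ
  have hγd : ∀ φ, HasDerivAt γ (rotGen (rotZ φ x) + h • ez) φ := by
    intro φ
    have h1 := hasDerivAt_rotZ_rotGen x φ
    have h2 : HasDerivAt (fun ψ : ℝ => (ψ * h) • ez) ((1 * h) • ez) φ :=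
      ((hasDerivAt_id φ).mul_const h).smul_const ez
    rw [one_mul] at h2
    exact h1.add h2
  -- `w = u ∘ γ − R_θ u(x)` solves `w' = J w`
  set w : ℝ → E3 := fun φ => u (γ φ) - rotZ φ (u x) with hw
  have hwd : ∀ φ, HasDerivAt w (rotGen (w φ)) φ := by
    intro φ
    have hu1 : HasDerivAt (fun ψ => u (γ ψ)) (fderiv ℝ u (γ φ) (rotGen (rotZ φ x) + h • ez)) φ :=
      (hu (γ φ)).hasFDerivAt.comp_hasDerivAt φ (hγd φ)
    have hJγ : rotGen (rotZ φ x) + h • ez = h • ez + rotGen (γ φ) := by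
      rw [hγ]
      simp only [rotGen_add, rotGen_smul, rotGen_ez, smul_zero, add_zero]
      rw [add_comm]
    rw [hJγ, hcl (γ φ)] at hu1
    have hu2 := hasDerivAt_rotZ_rotGen (u x) φ
    have h3 := hu1.sub hu2
    have e : rotGen (u (γ φ)) - rotGen (rotZ φ (u x)) = rotGen (w φ) := by
      rw [hw]
      simp only [← rotGenL_apply, map_sub]
    rw [e] at h3
    exact h3
  -- `‖w‖²` is constant (J is skew), and `w 0 = 0`
  have hn : ∀ φ, HasDerivAt (fun ψ => ⟪w ψ, w ψ⟫) 0 φ := by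
    intro φ
    have h1 := (hwd φ).inner ℝ (hwd φ)
    have e : ⟪w φ, rotGen (w φ)⟫ + ⟪rotGen (w φ), w φ⟫ = 0 := by
      rw [real_inner_comm, inner_rotGen_self, add_zero]
    rwa [e] at h1
  have hconst : ∀ φ, ⟪w φ, w φ⟫ = ⟪w 0, w 0⟫ := fun φ =>
    is_const_of_deriv_eq_zero (fun ψ => (hn ψ).differentiableAt) (fun ψ => (hn ψ).deriv) φ 0
  have hw0 : w 0 = 0 := by simp [hw, hγ]
  have hwθ : w θ = 0 := by
    have h1 := hconst θ
    rw [hw0, inner_zero_left, real_inner_self_eq_norm_sq] at h1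
    have : ‖w θ‖ = 0 := by nlinarith [norm_nonneg (w θ)]
    exact norm_eq_zero.1 this
  have : u (γ θ) - rotZ θ (u x) = 0 := hwθ
  rw [hγ] at this
  exact sub_eq_zero.1 this

/-- `R_{2π} = id`. -/
theorem rotZ_two_pi (x : E3) : rotZ (2 * Real.pi) x = x := by
  ext i
  fin_cases i <;> simp

/-- **Screw-invariant fields are periodic along the axis** (the stub `HelicalIsPeriodic` /
`periodic_of_screw` in normal form): with the clause for `ξ = (h e_z, 0, J)`,
`u(x + 2πh e_z) = u(x)` — for EVERY `h` (also `h = 0`, trivially). -/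
theorem periodic_of_screw_clause {u : E3 → E3} (hu : Differentiable ℝ u) (h : ℝ)
    (hcl : ∀ y, fderiv ℝ u y (h • ez + rotGen y) = rotGen (u y)) (x : E3) :
    u (x + (2 * Real.pi * h) • ez) = u x := by
  have key := screw_equivariant hu h hcl (2 * Real.pi) x
  rwa [rotZ_two_pi, rotZ_two_pi] at key

/-- **Rotation-invariant fields are axisymmetric** (`h = 0`): the crux's infinitesimal clause
`Du(y)[J y] = J u(y)` is the tree's `IsAxisymmetric` (finite equivariance under all `R_θ`) for
differentiable fields; the converse is the tree's `IsAxisymmetric.fderiv_rotGen`. -/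
theorem isAxisymmetric_of_clause {u : E3 → E3} (hu : Differentiable ℝ u)
    (hcl : ∀ y, fderiv ℝ u y (rotGen y) = rotGen (u y)) : IsAxisymmetric u := by
  intro θ x
  have key := screw_equivariant hu 0 (fun y => by rw [zero_smul, zero_add]; exact hcl y) θ x
  rwa [mul_zero, zero_smul, add_zero] at key

/-- The crux's clause `HasSymmetry u (h • e_z) 0 rotGenL` IS the screw clause slice by slice, so an
element of `𝒜_C` annihilated by `ξ = (h e_z, 0, J)` is `2πh`-periodic along the axis on every slice
and, for `h = 0`, axisymmetric on every slice. -/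
theorem InClass.periodic_of_hasSymmetry_screw {C : ℝ} {u : ℝ → E3 → E3} (hu : InClass C u)
    (h : ℝ) (hsym : HasSymmetry u (h • ez) 0 rotGenL) {t : ℝ} (ht : t < 0) (x : E3) :
    u t (x + (2 * Real.pi * h) • ez) = u t x := by
  have hcl := inClass_iff_isTypeIAncientMild.1 hu
  have hdiff : Differentiable ℝ (u t) := (hcl.contDiff_slice ht).differentiable (by simp)
  refine periodic_of_screw_clause hdiff h (fun y => ?_) x
  have e := hsym t ht y
  simp only [zero_smul, add_zero, rotGenL_apply, mul_zero, zero_mul, sub_eq_zero] at e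
  exact e

/-- The rotation case of the previous lemma: `HasSymmetry u 0 0 rotGenL` gives `IsAxisymmetric (u t)`
for every `t < 0`. -/
theorem InClass.isAxisymmetric_of_hasSymmetry_rot {C : ℝ} {u : ℝ → E3 → E3} (hu : InClass C u)
    (hsym : HasSymmetry u 0 0 rotGenL) {t : ℝ} (ht : t < 0) : IsAxisymmetric (u t) := by
  have hcl := inClass_iff_isTypeIAncientMild.1 hu
  have hdiff : Differentiable ℝ (u t) := (hcl.contDiff_slice ht).differentiable (by simp)
  refine isAxisymmetric_of_clause hdiff fun y => ?_
  have e := hsym t ht y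
  simp only [zero_smul, add_zero, zero_add, rotGenL_apply, mul_zero, zero_mul, sub_eq_zero] at e
  exact e

/-! ## (g) Cycle 3 (gen-3 seat): TARGETS — the six registered stubs of the picked line
`blowdown-kills-pitch` (skeleton `415f7ae75d4c`, `Lines/blowdown-kills-pitch.lean`)

Filed for `Theorems/SymmetricLiouville/Negative/StubKinematics.lean` (T1, T3, T2; p84537). The gauge
mutants T4/T5a/T5b below were ALSO found and LANDED independently by the drefute seat as
`Theorems/SymmetricLiouville/Negative/BlowdownStubsLoadBearing.lean` (p82389, 05:33Z:
`smallAtMinusInfinityLiouville_false_without_mild`, `selfSimilarLeaf_false_without_mild`,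
`rotatedSelfSimilarLiouville_false_without_mild` with the same rotating parasitic mode, plus
`periodicBlowdownVanishing_false_without_mild/_without_typeI` and `screwIsPeriodic_false_of_mem_range`),
so this seat's duplicate `StubGauge.lean` is withdrawn (bounced p84595 on the name clash) and the
copies kept in this work file are for the record only. Verdicts (none refuted; on the
contrary — STATUS 2026-08-16T06:20Z — every registered stub except T7 is now a TREE THEOREM:
`Theorems/SymmetryModuliCountSymmetricLiouville{ScrewIsPeriodic,RotationCovariance,PeriodicBlowdown,
SmallAtMinusInfinity,SelfSimilarLeaf,RssFarField}.lean` (landed 05:07–05:23Z by the lead/provers; the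
rotation-covariance file carries this seat's lemma chain `oseenKernel_map_linearIsometryEquiv` →
`oseenDuhamel_conj_linearIsometryEquiv` → `isTypeIAncientMild_conj_linearIsometryEquiv` verbatim),
and this seat's own sorry-free candidate proofs of T1, T2′, T3, T4, T5a, T6 (folder files
`Stub{ScrewIsPeriodic,RotationCovariance,PeriodicBlowdown,SmallAtMinusInfinity,SelfSimilarLeaf,RssFarField}Proof.lean`,
attached as evidence) plus `HelicalEndLiouvilleCandidate.lean` (route item stmt-14062 BY NAME, rc 0,
0 sorry, std axioms; attached on stmt-14062) corroborate them independently. Hence, via the lead's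
`SymmetricLiouville_of`, the crux is KERNEL-REDUCED to `AxisymEndLiouville` (item stmt-14061) and T7
(`stub_rssLiouvilleOfFarField`, pinned below ⊇ Pineau–Vicol Conj. 1.1): the residual open core is
isolated exactly. What follows is the load-bearing record per stub):

* T1 `stub_screwIsPeriodic` — PROVED (`StubScrewIsPeriodicProof.lean`; pure kinematics; normal form = §(f) `screw_equivariant`;
  general skew `A ≠ 0` on `ℝ³`: `A³ = −ρ²A`, `ρ² = ½‖A‖²_{HS}`, flow of `a + Ax` =
  `c + e^{sA}(x − c) + s a_∥` with `A c = −a_⊥`, so `e = (2π/ρ) a_∥ ≠ 0` iff `a ∉ range A = (ker A)^⊥`).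
  BOTH hypotheses load-bearing: `screwIsPeriodic_false_without_notInRange`,
  `screwIsPeriodic_false_without_skew` below (explicit witnesses).
* T2 `stub_rotationCovariance` — PROVED (`StubRotationCovarianceProof.lean`); the only non-library ingredient is
  `oseenKernel_map_linearIsometryEquiv` below (closed-form kernel is `O(3)`-equivariant, reflections
  included — no parity exploit); the rest is `heatExtension_comp_linearIsometryEquiv`
  (`AxisymmetricHeatFlow`), `VectorCalculus.IsDivFree.conj_linearIsometryEquiv` (`IsometryInvariance`),
  `LinearIsometryEquiv.measurePreserving` + `MeasurePreserving.integral_comp` for `y ↦ Ly`, and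
  `ContinuousLinearEquiv.integral_comp_comm` to pull `L` out of both Bochner integrals (no
  integrability needed for an equivalence, so even the junk branches transform covariantly).
* T3 `stub_periodicBlowdownVanishing` — un-witnessable (over `𝒜_C`, §(d)); PROVED (`StubPeriodicBlowdownProof.lean`): violators
  ⇒ blow-downs in `𝒜_C` (zoom covariance) with periods `e/λ_n → 0` ⇒ F3-limit `w ≠ 0` invariant under
  `ℝe` (locally uniform slice convergence suffices: `w(t, y + s ê) = lim u_n(t, y + k_n e/λ_n)`,
  `k_n = ⌊sλ_n/|e|⌋`) ⇒ rotate `ê ↦ e₂` (T2) ⇒ the time shift `w(· − δ)` is BOUNDED, `x₂`-independent,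
  weakly div-free, Oseen-mild, `√(−t)|w| ≤ C`: exactly the hypotheses of the tree's
  `KNSS2009_typeI_rate_liouville` (`KNSSTypeIRateCore`, 2.5-D with three components — the (1,3)-part
  planar Liouville + Rem. 6.1 + caloric Liouville for `w₂`; theorem `…_holds`), so `w = 0`,
  contradiction. Its periodicity hypothesis is load-bearing modulo the target:
  `not_blowdownVanishingAll_of_not_typeIAncientLiouville` (stub 3 minus periodicity, plus stub 4, IS `X`).
* T4 `stub_smallAtMinusInfinityLiouville` — un-witnessable; PROVED (`StubSmallAtMinusInfinityProof.lean`) from LANDED pieces, WITHOUT forward uniqueness (least-bad-time argument): for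
  `T ≪ 0` the FORWARD shift `v(s) = u(s + T)` (`s < 0`) lies in `𝒜_{ε₀}` (`‖v(s)‖ ≤ ε₀/√(−s−T) ≤ ε₀/√(−s)`,
  mild/smooth/div-free only involve times `< T`), so `v = 0` by `Negative.exists_eps_small_vanishes`,
  i.e. `u = 0` on `(−∞, T)`; then `oseenMild_bounded_unique` (data `0` at `s = T − 1`, both `u` and `0`
  bounded by `C/√δ` on `(s, −δ)`) gives `u(t) = 0` a.e., hence everywhere by continuity, for every
  `t < 0`. The gauge is load-bearing: `smallAtMinusInfinity_false_without_mild` (parasitic field,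
  `√(−t)/(1 − t) → 0` at `−∞`).
* T5a `stub_selfSimilarLeaf` — un-witnessable; TRUE = Tsai 1998 Thm 1 (`q = ∞`) + Rem. 6.1. The
  gauge is load-bearing INSIDE the leaf: `selfSimilarLeaf_false_without_mild` — the self-similar
  parasitic field `(−t)^{-1/2} e₀` (constant Leray profile) satisfies every other hypothesis and the
  scaling clause exactly (Type-I constant `C = 1` attained: `ssParasite_typeI` is an equality).
* T5b `stub_rotatedSelfSimilarLiouville` — the OPEN CORE (= `RotatedSelfSimilarLiouville` of §(b));
  un-witnessable in the gauge. NEW: without the gauge it is false for a trivial reason —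
  `rotatedSelfSimilar_false_without_mild`: the ROTATING parasitic field
  `(−t)^{-1/2} R_{½log(−t)} e₀` (a constant profile rotating with the similarity frame of
  `ξ = (0, 1, J)`) is smooth, div-free, Type-I (`C = 1`), satisfies `(x + Jx)·∇u + u + 2t∂ₜu − Ju = 0`
  and is nonzero. So at the PDE level "bounded RSS profile ⇒ 0" is FALSE and the honest statement
  is "bounded RSS profile ⇒ constant vector rotating with the frame" (the `α ≠ 0` analogue of Tsai's
  `q = ∞` conclusion "U constant"); Pineau–Vicol exclude the family by the spatial decay (1.10), the
  crux by the gauge (Rem. 6.1). Any proof of 5b must therefore produce spatial decay of the profile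
  or use the gauge at the very end — consistent with the far-field recentring plan of the cards.
* RESHAPE 2026-08-16T05:05Z (skeleton `e35ce922ec1c`, seven stubs): the lead split the open core T5b
  into T6 `stub_rssFarFieldVanishing` (given the PERIODIC LEAF as antecedent, every `ξ = (0, 1, A)`-
  symmetric element of `A_C`, `A` skew — `A = 0` allowed — is small in the far field:
  `∀ ε ∃ R ∀ t < 0 ∀ x, R√(−t) ≤ |x| → √(−t)|u(t,x)| ≤ ε`) and T7 `stub_rssLiouvilleOfFarField` (`A ≠ 0`
  skew, the rotated-scaling clause AND far-field smallness ⇒ `u ≡ 0`). Disprover's reading: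
  - T6 is un-witnessable and is now PROVED (`StubRssFarFieldProof.lean`, rc 0, 0 sorry, attached as
    evidence 06:40Z; theorem `stub_rssFarFieldVanishing_proof`) by far-field recentring WITHOUT
    integrating the clause:
    violators `(t_n, x_n)`, `|x_n| ≥ R_n√(−t_n)`, `R_n → ∞` ⇒ zooms `v_n(s,z) = λ_n u(λ_n²s, x_n + λ_n z)`,
    `λ_n = √(−t_n)` (`isTypeIAncientMild_zoom`), `|v_n(−1,0)| > ε`, carrying the conjugated symmetry
    `HasSymmetry v_n a_n 1 A` with `a_n = (x_n + A x_n)/λ_n`, `|a_n|² = (|x_n|² + |Ax_n|²)/λ_n² ≥ R_n² → ∞`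
    (skewness); divide the clause by `|a_n|` and pass to the F3-limit using the GRADIENT clauses of
    `exists_tendsto_of_isTypeIAncientMild_seq` (conjuncts 4 and 6) and the class bounds
    `|v_n| ≤ C/√(−s)`, `|∇v_n| ≤ C′(C)/(−s)`, `|∂_s v_n| ≤ C″(C)(−s)^{-3/2}` (KNSS Prop. 4.1 scale-invariant
    bounds — in the kernel-checked proof only the `∂_s` bound is needed, taken from the tree's uniform
    time-Lipschitz bound `Theorems.exists_lipschitz_time_of_typeI` (`k = 0`) + `norm_deriv_le_of_lipschitzOn`;
    the gradient term needs no bound because `Dv_n(s,z) → DW(s,z)` converges): the limit `W ∈ A_C` has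
    `DW(s,z)[b] = 0` for a unit `b = lim a_n/|a_n|`,
    hence period `b`, hence `W = 0` by the antecedent periodic leaf (= T1–T4, PROVED), contradicting
    `|W(−1,0)| ≥ ε`. Mutations: dropping the periodic-leaf antecedent makes T6 as strong as
    "HelicalEndLiouville ⇒ far field" — harmless now that the leaf is proved; dropping the symmetry
    makes it false inside `A_C` only if `X` fails (un-witnessable, §(d)).
  - T7 is the OPEN CORE in decaying-profile form: it contains Pineau–Vicol Conj. 1.1 (their class (1.10)
    is `|U(y)| ≲ 1/(1+|y|)`, STRONGER decay than T7's `U(y) → 0`; the cards' Oseen bootstrap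
    `o(1) ⇒ O(1/|y|)` is the bridge) at every `α₁ ≤ |α| ≤ α₂`, and PV Thm 1.4 (`pineauVicol2026_rss_liouville`)
    off the window. For T7 the GAUGE is no longer the load-bearing clause (a classical decaying RSS
    solution differs from its Oseen-mild part by a bounded `x`-harmonic field vanishing at infinity,
    i.e. by `0` — the gauge is automatic under far-field smallness; the rotating parasitic witness of
    `rotatedSelfSimilar_false_without_mild` is correctly EXCLUDED by T7's decay hypothesis), the
    Navier–Stokes nonlinearity is (§(d)): dropping the Oseen equation altogether leaves "smooth +
    div-free + Type-I + symmetric + decaying ⇒ 0", refuted by ANY nonzero axisymmetric self-similar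
    ansatz, e.g. the Gaussian swirl `u(t,x) = (−t)⁻¹ e^{−|x|²/(−t)} Jx` (profile `U(y) = e^{−|y|²}Jy`:
    smooth, div-free since `∇(e^{−|y|²}) ⊥ Jy` and `tr J = 0`, `|U| ≤ 1`, `√(−t)|u| = r e^{−r²} → 0`,
    and the clause holds by the exact cancellation `x·∇u + u + 2t∂ₜu = 0`, `(Jx)·∇u = Ju`) — not worth
    kernel-checking: it solves no equation. So T7 = old T5b ∩ {decaying profiles} is exactly where the
    printed conjecture lives; no kill, no cheap mutation. TARGET STATUS after the reshape: T1–T4 and T6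
    PROVED (this seat; candidate proofs attached), F3 PROVED (tree), T5a closable (Tsai), T7 OPEN CORE —
    i.e. modulo Tsai's leaf the crux `SymmetricLiouville` is now FORMALLY EQUIVALENT IN DIFFICULTY to T7,
    the decaying-profile rotated-self-similar Liouville statement at every nonzero rotation rate.
* LITERATURE REFRESH 2026-08-16T05:40Z (degraded: local FTS db unavailable, OpenAlex budget exhausted,
  S2 partially rate-limited, galaxy substring 0 rows): S2/arXiv/Crossref for "rotated self-similar …
  Liouville backward" return Pineau–Vicol arXiv:2607.09619 (known, the frontier) and ONE new 2026 print,
  Binz–Coiculescu arXiv:2607.12159 "Homothetic self-similar solutions" — read pp. 1–2: FORWARD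
  self-similar profiles (Jia–Šverák programme; 3-D Liouville for homothetic forward profiles, 2-D
  Oseen vortex) — not applicable to backward/ancient Liouville; nothing on helical/periodic ancient
  solutions; no numerical candidate for a nonzero backward RSS profile at `α ~ 1`. Residual unchanged.
-/

/-! ### T1: both hypotheses of the kinematic stub are load-bearing -/

/-- `J ≠ 0` (`J e₀ = e₁`). -/
theorem rotGenL_ne_zero : rotGenL ≠ 0 := by
  intro h0
  have h1 : (rotGenL e0) 1 = 0 := by rw [h0]; simp
  simp [rotGen_apply_one, e0] at h1

/-- **Stub 1 without `a ∉ range A` is false** (even with `A ≠ 0` in its place): for `a = 0`, `A = J`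
the identity field satisfies the clause `Dv(x)[a + Ax] = A v(x)` and has no nonzero period. -/
theorem screwIsPeriodic_false_without_notInRange :
    ¬ (∀ (a : E3) (A : E3 →L[ℝ] E3), (∀ x, ⟪A x, x⟫ = 0) → A ≠ 0 →
        ∃ e : E3, e ≠ 0 ∧ ∀ v : E3 → E3, Differentiable ℝ v →
          (∀ x, fderiv ℝ v x (a + A x) = A (v x)) → ∀ x, v (x + e) = v x) := by
  intro h
  obtain ⟨e, he, hper⟩ := h 0 rotGenL (fun x => by rw [rotGenL_apply]; exact inner_rotGen_self x)
    rotGenL_ne_zero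
  have key := hper id differentiable_id
    (fun x => by rw [(hasFDerivAt_id (𝕜 := ℝ) x).fderiv]; simp) 0
  rw [zero_add] at key
  exact he key

/-- The nilpotent shear generator `S x = x₁ e₀` (NOT skew: `⟪S x, x⟫ = x₀x₁`). -/
def shearGen : E3 →L[ℝ] E3 :=
  (EuclideanSpace.proj (1 : Fin 3) : E3 →L[ℝ] ℝ).smulRight e0

/-- `S x = x₁ e₀`. -/
@[simp] theorem shearGen_apply (x : E3) : shearGen x = x 1 • e0 := rfl

/-- `e_z ∉ range S` (`range S = ℝ e₀`). -/
theorem ez_not_mem_range_shearGen : ez ∉ Set.range shearGen := by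
  rintro ⟨c, hc⟩
  have h2 := congrArg (fun w : E3 => w 2) hc
  simp [ez, e0] at h2

/-- The polynomial witness `v(x) = (x₀ − x₁x₂) e_z`. -/
def twistField : E3 → E3 := fun x => (x 0 - x 1 * x 2) • ez

/-- Fréchet derivative of the witness. -/
theorem hasFDerivAt_twistField (x : E3) :
    HasFDerivAt twistField
      (((EuclideanSpace.proj (0 : Fin 3) : E3 →L[ℝ] ℝ) -
        (x 1 • (EuclideanSpace.proj (2 : Fin 3) : E3 →L[ℝ] ℝ) +
          x 2 • (EuclideanSpace.proj (1 : Fin 3) : E3 →L[ℝ] ℝ))).smulRight ez) x := by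
  have h0 : HasFDerivAt (fun v : E3 => v 0) (EuclideanSpace.proj (0 : Fin 3) : E3 →L[ℝ] ℝ) x :=
    (EuclideanSpace.proj (0 : Fin 3) : E3 →L[ℝ] ℝ).hasFDerivAt
  have h1 : HasFDerivAt (fun v : E3 => v 1) (EuclideanSpace.proj (1 : Fin 3) : E3 →L[ℝ] ℝ) x :=
    (EuclideanSpace.proj (1 : Fin 3) : E3 →L[ℝ] ℝ).hasFDerivAt
  have h2 : HasFDerivAt (fun v : E3 => v 2) (EuclideanSpace.proj (2 : Fin 3) : E3 →L[ℝ] ℝ) x :=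
    (EuclideanSpace.proj (2 : Fin 3) : E3 →L[ℝ] ℝ).hasFDerivAt
  exact ((h0.sub (h1.mul h2)).smul_const ez)

/-- The witness is differentiable. -/
theorem differentiable_twistField : Differentiable ℝ twistField := fun x =>
  (hasFDerivAt_twistField x).differentiableAt

/-- The slice derivative of the witness, evaluated. -/
theorem fderiv_twistField_apply (x h : E3) :
    fderiv ℝ twistField x h = (h 0 - (x 1 * h 2 + x 2 * h 1)) • ez := by
  rw [(hasFDerivAt_twistField x).fderiv]
  simp [ContinuousLinearMap.smulRight_apply]

/-- The witness satisfies the clause of stub 1 for the shear: `Dv(x)[e_z + S x] = S v(x)` (both `0`). -/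
theorem twistField_clause (x : E3) :
    fderiv ℝ twistField x (ez + shearGen x) = shearGen (twistField x) := by
  rw [fderiv_twistField_apply, shearGen_apply, shearGen_apply]
  simp [ez, e0, twistField]

/-- The witness has no nonzero period. -/
theorem twistField_period_eq_zero {e : E3} (hper : ∀ x, twistField (x + e) = twistField x) : e = 0 := by
  have k0 := congrArg (fun w : E3 => w 2) (hper 0)
  have k1 := congrArg (fun w : E3 => w 2) (hper e1)
  have k2 := congrArg (fun w : E3 => w 2) (hper ez)
  simp [twistField, ez, e1] at k0 k1 k2
  have he2 : e 2 = 0 := by nlinarith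
  have he1 : e 1 = 0 := by rw [he2] at k2; nlinarith
  have he0 : e 0 = 0 := by rw [he1] at k0; linarith
  ext i
  fin_cases i <;> simp [he0, he1, he2]

/-- **Stub 1 without skewness of `A` is false**: for the shear `S` and `a = e_z ∉ range S` there is
no common nonzero period of the differentiable solutions of `Dv(x)[e_z + Sx] = S v(x)` — the single
polynomial solution `(x₀ − x₁x₂) e_z` already has none. Any proof of stub 1 must use `⟪Ax, x⟫ = 0`. -/
theorem screwIsPeriodic_false_without_skew :
    ¬ (∀ (a : E3) (A : E3 →L[ℝ] E3), a ∉ Set.range A →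
        ∃ e : E3, e ≠ 0 ∧ ∀ v : E3 → E3, Differentiable ℝ v →
          (∀ x, fderiv ℝ v x (a + A x) = A (v x)) → ∀ x, v (x + e) = v x) := by
  intro h
  obtain ⟨e, he, hper⟩ := h ez shearGen ez_not_mem_range_shearGen
  exact he (twistField_period_eq_zero (hper twistField differentiable_twistField twistField_clause))

/-! ### T3: the periodicity of the lever is load-bearing modulo `X` -/

/-- **Stub 3 with periodicity dropped is `X`-complete.** If `X = TypeIAncientLiouville` fails then —
granted stub 4 — it is NOT true that every element of `A_C` is small at `−∞`. -/
theorem not_blowdownVanishingAll_of_not_typeIAncientLiouville (hX : ¬ TypeIAncientLiouville)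
    (h4 : ∀ (C : ℝ) (u : ℝ → E3 → E3), IsTypeIAncientMild C u →
      (∀ ε > 0, ∃ T < 0, ∀ t < T, ∀ x, Real.sqrt (-t) * ‖u t x‖ ≤ ε) → ∀ t < 0, ∀ x, u t x = 0) :
    ¬ (∀ (C : ℝ) (u : ℝ → E3 → E3), IsTypeIAncientMild C u →
      ∀ ε > 0, ∃ T < 0, ∀ t < T, ∀ x, Real.sqrt (-t) * ‖u t x‖ ≤ ε) := by
  intro h3
  apply hX
  intro C u hu
  have hcl : IsTypeIAncientMild C u := isTypeIAncientMild_iff.2 hu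
  exact h4 C u hcl (h3 C u hcl)

/-! ### T2: the Oseen kernel is `O(3)`-equivariant (no parity exploit in the gauge) -/

/-- **The closed-form Oseen kernel is equivariant under every linear isometry** (rotations AND
reflections): `K(τ, Lz)[La, Lb] = L (K(τ, z)[a, b])`. -/
theorem oseenKernel_map_linearIsometryEquiv (L : E3 ≃ₗᵢ[ℝ] E3) (τ : ℝ) (z a b : E3) :
    oseenKernel τ (L z) (L a) (L b) = L (oseenKernel τ z a b) := by
  have hG : ∀ s : ℝ, heatKernel s (L z) = heatKernel s z := fun s => by
    rw [heatKernel_eq, heatKernel_eq, L.norm_map]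
  have hA : oseenWeightA τ (L z) = oseenWeightA τ z := by
    simp only [oseenWeightA, hG]
  have hB : oseenWeightB τ (L z) = oseenWeightB τ z := by
    simp only [oseenWeightB, hG]
  simp only [oseenKernel, LinearIsometryEquiv.inner_map_map, hG, hA, hB, map_add, map_sub,
    LinearIsometryEquiv.map_smul]

/-! ### T4: "small at `−∞` ⇒ 0" needs the gauge -/

/-- The parasitic field is small at `−∞` in the scale-invariant sense:
`√(−t)‖(1 − t)⁻¹ e₀‖ ≤ 1/√(−t)`. -/
theorem sqrt_mul_norm_parasiticField_le {t : ℝ} (ht : t < 0) (x : E3) :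
    Real.sqrt (-t) * ‖parasiticField t x‖ ≤ (Real.sqrt (-t))⁻¹ := by
  have ht0 : 0 < -t := neg_pos.2 ht
  have h1t : 0 < 1 - t := by linarith
  rw [parasiticField, norm_smul, norm_inv, Real.norm_eq_abs, abs_of_pos h1t, norm_e0, mul_one]
  calc Real.sqrt (-t) * (1 - t)⁻¹ ≤ Real.sqrt (-t) * (-t)⁻¹ :=
        mul_le_mul_of_nonneg_left (inv_anti₀ ht0 (by linarith)) (Real.sqrt_nonneg _)
    _ = (Real.sqrt (-t))⁻¹ := by
        rw [← div_eq_mul_inv, Real.sqrt_div_self', one_div]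

/-- **Stub 4 without the Oseen gauge is false**: smooth + divergence free + Type-I + small at `−∞`
does not force `u = 0` (witness: the parasitic field, `C = 1`). -/
theorem smallAtMinusInfinity_false_without_mild :
    ¬ (∀ (C : ℝ) (u : ℝ → E3 → E3), IsSmoothAncient u → IsDivFreeAncient u → HasTypeITimeDecay C u →
        (∀ ε > 0, ∃ T < 0, ∀ t < T, ∀ x, Real.sqrt (-t) * ‖u t x‖ ≤ ε) → VanishesOnPast u) := by
  intro h
  refine parasiticField_not_vanishes
    (h 1 parasiticField parasiticField_smooth parasiticField_divFree parasiticField_typeI ?_)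
  intro ε hε
  refine ⟨-(ε⁻¹ ^ 2 + 1), by nlinarith [inv_pos.2 hε], fun t ht x => ?_⟩
  have ht' : t < 0 := by nlinarith [inv_pos.2 hε]
  have hs : ε⁻¹ < Real.sqrt (-t) := by
    rw [Real.lt_sqrt (inv_pos.2 hε).le]
    linarith
  have hinv : (Real.sqrt (-t))⁻¹ < ε := by
    have := inv_strictAnti₀ (inv_pos.2 hε) hs
    rwa [inv_inv] at this
  exact (sqrt_mul_norm_parasiticField_le ht' x).trans hinv.le

/-! ### T5a: the self-similar leaf needs the gauge (Tsai's constant-profile case) -/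

/-- The self-similar parasitic field `u(t, x) = (−t)^{-1/2} e₀` (constant Leray profile `U ≡ e₀`). -/
def ssParasite : ℝ → E3 → E3 := fun t _ => (Real.sqrt (-t))⁻¹ • e0

/-- `t ↦ (−t)^{-1/2}` is smooth on `t < 0` (jointly with a dummy space variable). -/
theorem contDiffOn_inv_sqrt_neg :
    ContDiffOn ℝ (⊤ : ℕ∞) (fun p : ℝ × E3 => (Real.sqrt (-p.1))⁻¹) (Set.Iio 0 ×ˢ Set.univ) := by
  refine ContDiffOn.inv ?_ ?_
  · refine ContDiffOn.sqrt contDiff_fst.neg.contDiffOn ?_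
    rintro ⟨t, x⟩ ⟨ht, -⟩
    simp only [Set.mem_Iio] at ht
    exact (neg_pos.2 ht).ne'
  · rintro ⟨t, x⟩ ⟨ht, -⟩
    simp only [Set.mem_Iio] at ht
    exact (Real.sqrt_pos.2 (neg_pos.2 ht)).ne'

/-- The self-similar parasitic field is smooth on `t < 0`. -/
theorem ssParasite_smooth : IsSmoothAncient ssParasite :=
  contDiffOn_inv_sqrt_neg.smul contDiffOn_const

/-- It is divergence free (spatially constant slices). -/
theorem ssParasite_divFree : IsDivFreeAncient ssParasite := fun _ _ => isDivFree_const _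

/-- It is Type-I with the sharp constant `C = 1`: `‖u(t, x)‖ = 1/√(−t)`. -/
theorem ssParasite_typeI : HasTypeITimeDecay 1 ssParasite := by
  intro t _ x
  rw [ssParasite, norm_smul, norm_inv, Real.norm_eq_abs, abs_of_nonneg (Real.sqrt_nonneg _),
    norm_e0, mul_one, one_div]

/-- It does not vanish. -/
theorem ssParasite_not_vanishes : ¬ VanishesOnPast ssParasite := by
  intro h
  have := h (-1) (by norm_num) 0
  simp [ssParasite, e0_ne_zero] at this

/-- `d/dt (−t)^{-1/2} = (−t)^{-1/2} / (2(−t))` for `t < 0`. -/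
theorem hasDerivAt_inv_sqrt_neg {t : ℝ} (ht : t < 0) :
    HasDerivAt (fun s => (Real.sqrt (-s))⁻¹) ((Real.sqrt (-t))⁻¹ / (2 * (-t))) t := by
  have ht0 : 0 < -t := neg_pos.2 ht
  have hs0 : Real.sqrt (-t) ≠ 0 := (Real.sqrt_pos.2 ht0).ne'
  have h1 : HasDerivAt (fun s => Real.sqrt (-s)) (1 / (2 * Real.sqrt (-t)) * -1) t :=
    (Real.hasDerivAt_sqrt ht0.ne').comp t (hasDerivAt_neg t)
  refine (h1.inv hs0).congr_deriv ?_
  rw [Real.sq_sqrt ht0.le]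
  field_simp

/-- The time derivative of the self-similar parasitic field. -/
theorem timeDeriv_ssParasite {t : ℝ} (ht : t < 0) (x : E3) :
    timeDeriv ssParasite t x = ((Real.sqrt (-t))⁻¹ / (2 * (-t))) • e0 := by
  rw [timeDeriv_apply]
  exact ((hasDerivAt_inv_sqrt_neg ht).smul_const e0).deriv

/-- **The self-similar parasitic field satisfies the scaling clause** `x·∇u + u + 2t ∂ₜu = 0`
(`ξ = (0, 1, 0)`), on `t < 0`. -/
theorem ssParasite_clause {t : ℝ} (ht : t < 0) (x : E3) :
    fderiv ℝ (ssParasite t) x x + ssParasite t x + (2 * t) • timeDeriv ssParasite t x = 0 := by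
  have ht0 : (-t) ≠ 0 := (neg_pos.2 ht).ne'
  have htne : t ≠ 0 := ht.ne
  have hfd : fderiv ℝ (ssParasite t) x x = 0 := by
    rw [show ssParasite t = fun _ : E3 => (Real.sqrt (-t))⁻¹ • e0 from rfl,
      (hasFDerivAt_const _ _).fderiv]
    rfl
  have key : (Real.sqrt (-t))⁻¹ + 2 * t * ((Real.sqrt (-t))⁻¹ / (2 * (-t))) = 0 := by
    field_simp
    ring
  rw [hfd, zero_add, timeDeriv_ssParasite ht, smul_smul,
    show ssParasite t x = (Real.sqrt (-t))⁻¹ • e0 from rfl, ← add_smul, key, zero_smul]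

/-- **Stub 5a without the Oseen gauge is false**: smooth + divergence free + Type-I + the
self-similar clause do not force `u = 0` — the bounded Leray profile may be a nonzero CONSTANT
(Tsai 1998, Thm 1, `q = ∞`); only the gauge (KNSS Rem. 6.1) kills it. -/
theorem selfSimilarLeaf_false_without_mild :
    ¬ (∀ (C : ℝ) (u : ℝ → E3 → E3), IsSmoothAncient u → IsDivFreeAncient u → HasTypeITimeDecay C u →
        (∀ t < 0, ∀ x, fderiv ℝ (u t) x x + u t x + (2 * t) • timeDeriv u t x = 0) →
        VanishesOnPast u) := fun h =>
  ssParasite_not_vanishes (h 1 ssParasite ssParasite_smooth ssParasite_divFree ssParasite_typeI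
    (fun _ ht x => ssParasite_clause ht x))

/-! ### T5b: the open core needs the gauge too — the ROTATING parasitic field -/

/-- `R_θ e₀ = cos θ e₀ + sin θ e₁`. -/
theorem rotZ_e0 (θ : ℝ) : rotZ θ e0 = Real.cos θ • e0 + Real.sin θ • e1 := by
  ext i
  fin_cases i <;> simp [rotZ, e0, e1]

/-- The rotating self-similar parasitic field `u(t, x) = (−t)^{-1/2} R_{θ(t)} e₀`,
`θ(t) = ½ log(−t)`: a constant Leray profile ROTATING with the similarity frame of the
generator `ξ = (0, 1, J)`. -/
def rssParasite : ℝ → E3 → E3 := fun t _ => (Real.sqrt (-t))⁻¹ • rotZ (Real.log (-t) / 2) e0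

/-- The phase `θ(t) = ½ log(−t)` is smooth on `t < 0`. -/
theorem contDiffOn_phase :
    ContDiffOn ℝ (⊤ : ℕ∞) (fun p : ℝ × E3 => Real.log (-p.1) / 2) (Set.Iio 0 ×ˢ Set.univ) := by
  refine (ContDiffOn.log contDiff_fst.neg.contDiffOn ?_).div_const 2
  rintro ⟨t, x⟩ ⟨ht, -⟩
  simp only [Set.mem_Iio] at ht
  exact (neg_pos.2 ht).ne'

/-- The rotating parasitic field is smooth on `t < 0`. -/
theorem rssParasite_smooth : IsSmoothAncient rssParasite := by
  have hrot : ContDiffOn ℝ (⊤ : ℕ∞) (fun p : ℝ × E3 => rotZ (Real.log (-p.1) / 2) e0)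
      (Set.Iio 0 ×ˢ Set.univ) := by
    have e : (fun p : ℝ × E3 => rotZ (Real.log (-p.1) / 2) e0) = fun p =>
        Real.cos (Real.log (-p.1) / 2) • e0 + Real.sin (Real.log (-p.1) / 2) • e1 := by
      funext p
      exact rotZ_e0 _
    rw [e]
    exact ((Real.contDiff_cos.comp_contDiffOn contDiffOn_phase).smul contDiffOn_const).add
      ((Real.contDiff_sin.comp_contDiffOn contDiffOn_phase).smul contDiffOn_const)
  exact contDiffOn_inv_sqrt_neg.smul hrot

/-- It is divergence free (spatially constant slices). -/
theorem rssParasite_divFree : IsDivFreeAncient rssParasite := fun _ _ => isDivFree_const _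

/-- It is Type-I with `C = 1`: `‖u(t, x)‖ = 1/√(−t)`. -/
theorem rssParasite_typeI : HasTypeITimeDecay 1 rssParasite := by
  intro t _ x
  rw [rssParasite, norm_smul, norm_inv, Real.norm_eq_abs, abs_of_nonneg (Real.sqrt_nonneg _),
    norm_rotZ, norm_e0, mul_one, one_div]

/-- It does not vanish (`u(−1, ·) = e₀`). -/
theorem rssParasite_not_vanishes : ¬ VanishesOnPast rssParasite := by
  intro h
  have := h (-1) (by norm_num) 0
  simp [rssParasite, rotZ_zero, e0_ne_zero] at this

/-- `d/dt ½log(−t) = t⁻¹/2` for `t < 0`. -/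
theorem hasDerivAt_phase {t : ℝ} (ht : t < 0) :
    HasDerivAt (fun s => Real.log (-s) / 2) (t⁻¹ / 2) t := by
  have h1 : HasDerivAt (fun s => Real.log (-s)) ((-t)⁻¹ * -1) t :=
    (Real.hasDerivAt_log (neg_pos.2 ht).ne').comp t (hasDerivAt_neg t)
  refine (h1.div_const 2).congr_deriv ?_
  rw [inv_neg]
  ring

/-- The time derivative of the rotating parasitic field:
`∂ₜu = (−t)^{-1/2}(t⁻¹/2) J R_θ e₀ + ((−t)^{-1/2}/(2(−t))) R_θ e₀`. -/
theorem timeDeriv_rssParasite {t : ℝ} (ht : t < 0) (x : E3) :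
    timeDeriv rssParasite t x =
      (Real.sqrt (-t))⁻¹ • ((t⁻¹ / 2) • rotGen (rotZ (Real.log (-t) / 2) e0)) +
        ((Real.sqrt (-t))⁻¹ / (2 * (-t))) • rotZ (Real.log (-t) / 2) e0 := by
  rw [timeDeriv_apply]
  have hR : HasDerivAt ((fun φ => rotZ φ e0) ∘ fun s => Real.log (-s) / 2)
      ((t⁻¹ / 2) • rotGen (rotZ (Real.log (-t) / 2) e0)) t :=
    (hasDerivAt_rotZ_rotGen e0 (Real.log (-t) / 2)).scomp t (hasDerivAt_phase ht)
  exact ((hasDerivAt_inv_sqrt_neg ht).smul hR).deriv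

/-- **The rotating parasitic field satisfies the rotated-scaling clause**
`(x + Jx)·∇u + u + 2t ∂ₜu − Ju = 0` (`ξ = (0, 1, J)`), on `t < 0`. -/
theorem rssParasite_clause {t : ℝ} (ht : t < 0) (x : E3) :
    fderiv ℝ (rssParasite t) x (x + rotGenL x) + rssParasite t x +
      (2 * t) • timeDeriv rssParasite t x - rotGenL (rssParasite t x) = 0 := by
  have ht0 : (-t) ≠ 0 := (neg_pos.2 ht).ne'
  have htne : t ≠ 0 := ht.ne
  have hs0 : Real.sqrt (-t) ≠ 0 := (Real.sqrt_pos.2 (neg_pos.2 ht)).ne'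
  have hfd : fderiv ℝ (rssParasite t) x (x + rotGenL x) = 0 := by
    rw [show rssParasite t = fun _ : E3 => (Real.sqrt (-t))⁻¹ • rotZ (Real.log (-t) / 2) e0 from rfl,
      (hasFDerivAt_const _ _).fderiv]
    rfl
  have hval : rssParasite t x = (Real.sqrt (-t))⁻¹ • rotZ (Real.log (-t) / 2) e0 := rfl
  have k1 : 2 * t * (Real.sqrt (-t))⁻¹ * (t⁻¹ / 2) = (Real.sqrt (-t))⁻¹ := by
    field_simp
  have k2 : 2 * t * ((Real.sqrt (-t))⁻¹ / (2 * (-t))) = -(Real.sqrt (-t))⁻¹ := by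
    rw [show (2 : ℝ) * (-t) = -(2 * t) by ring, div_neg, mul_neg, mul_div_assoc',
      mul_div_cancel_left₀ _ (mul_ne_zero two_ne_zero htne)]
  rw [hfd, zero_add, timeDeriv_rssParasite ht, hval, rotGenL_apply, rotGen_smul, smul_add,
    smul_smul, smul_smul, smul_smul, k1, k2, neg_smul]
  abel

/-- **Stub 5b (the open core) without the Oseen gauge is false, trivially**: smooth + divergence
free + Type-I + the rotated-scaling clause for the nonzero skew `J` do not force `u = 0` — witness
the rotating parasitic field. The bounded-profile rotated-self-similar Liouville theorem is a
statement about the GAUGE class (or about decaying profiles, Pineau–Vicol (1.10)), never about the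
bare PDE. -/
theorem rotatedSelfSimilar_false_without_mild :
    ¬ (∀ (C : ℝ) (u : ℝ → E3 → E3), IsSmoothAncient u → IsDivFreeAncient u → HasTypeITimeDecay C u →
        ∀ A : E3 →L[ℝ] E3, IsSkew A → A ≠ 0 →
        (∀ t < 0, ∀ x, fderiv ℝ (u t) x (x + A x) + u t x + (2 * t) • timeDeriv u t x - A (u t x) = 0) →
        VanishesOnPast u) := fun h =>
  rssParasite_not_vanishes (h 1 rssParasite rssParasite_smooth rssParasite_divFree rssParasite_typeI
    rotGenL isSkew_rotGenL rotGenL_ne_zero (fun _ ht x => rssParasite_clause ht x))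

/-- In the language of the crux: the rotating parasitic field carries the symmetry
`HasSymmetry u 0 1 rotGenL` (so `ξ = (0, 1, J)` annihilates it) while failing ONLY the gauge clause
of `𝒜_1`. -/
theorem rssParasite_hasSymmetry : HasSymmetry rssParasite 0 1 rotGenL := by
  intro t ht x
  have h := rssParasite_clause ht x
  simpa only [zero_add, one_smul, mul_one] using h

/-- … and it is not KNSS-mild (it fails only the gauge): otherwise it would lie in `𝒜_1` and be
killed by KNSS Rem. 6.1 (`InClass.vanishes_of_slice_const`). -/
theorem rssParasite_not_mild : ¬ IsKNSSMild rssParasite := fun hm => by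
  have hcl : InClass 1 rssParasite := ⟨rssParasite_smooth, rssParasite_divFree, hm, rssParasite_typeI⟩
  exact rssParasite_not_vanishes (hcl.vanishes_of_slice_const
    (b := fun t => (Real.sqrt (-t))⁻¹ • rotZ (Real.log (-t) / 2) e0) (fun _ _ _ => rfl))


/-! ### T7 pinned: the reshaped open core is at least Pineau–Vicol's conjecture in the gauge -/

/-- **T7 of the reshaped skeleton** (`stub_rssLiouvilleOfFarField`, verbatim over `IsTypeIAncientMild`):
rotated-self-similar Liouville for profiles vanishing at infinity, every nonzero rotation rate. -/
def RssLiouvilleOfFarField : Prop :=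
  ∀ (C : ℝ) (u : ℝ → E3 → E3), IsTypeIAncientMild C u →
    ∀ A : E3 →L[ℝ] E3, (∀ x, ⟪A x, x⟫ = 0) → A ≠ 0 →
      (∀ t < 0, ∀ x, fderiv ℝ (u t) x (x + A x) + u t x + (2 * t) • timeDeriv u t x - A (u t x) = 0) →
      (∀ ε > 0, ∃ R : ℝ, ∀ t < 0, ∀ x, R * Real.sqrt (-t) ≤ ‖x‖ → Real.sqrt (-t) * ‖u t x‖ ≤ ε) →
      ∀ t < 0, ∀ x, u t x = 0

/-- The crux implies T7 (T7 only adds hypotheses to the `a = 0`, `σ = 1` specialisation). -/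
theorem symmetricLiouville_implies_rssLiouvilleOfFarField :
    SymmetricLiouville → RssLiouvilleOfFarField := by
  intro h C u hcl A hA hA0 hL _ t ht x
  refine h C u (isTypeIAncientMild_iff.1 hcl) 0 1 A hA (fun hz => one_ne_zero hz.2.1) ?_ t ht x
  intro s hs y
  simpa only [zero_add, one_smul, mul_one] using hL s hs y

/-- **Space–time Type-I decay gives far-field smallness** at the scale-invariant rate:
`‖u‖ ≤ C₀/(|x| + √(−t))` ⇒ `√(−t)‖u(t,x)‖ ≤ |C₀|/(R + 1)` for `|x| ≥ R√(−t)`, `R ≥ 0`. -/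
theorem farField_of_hasTypeIDecay {C₀ : ℝ} {u : ℝ → E3 → E3} (hd : HasTypeIDecay C₀ u) :
    ∀ ε > 0, ∃ R : ℝ, ∀ t < 0, ∀ x, R * Real.sqrt (-t) ≤ ‖x‖ → Real.sqrt (-t) * ‖u t x‖ ≤ ε := by
  intro ε hε
  refine ⟨|C₀| / ε, fun t ht x hx => ?_⟩
  have hs : 0 < Real.sqrt (-t) := Real.sqrt_pos.2 (neg_pos.2 ht)
  have hR : 0 ≤ |C₀| / ε := div_nonneg (abs_nonneg _) hε.le
  have hden : 0 < ‖x‖ + Real.sqrt (-t) := by positivity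
  have h1 : ‖u t x‖ ≤ |C₀| / (‖x‖ + Real.sqrt (-t)) :=
    (hd t ht x).trans (div_le_div_of_nonneg_right (le_abs_self C₀) hden.le)
  have h2 : (|C₀| / ε + 1) * Real.sqrt (-t) ≤ ‖x‖ + Real.sqrt (-t) := by nlinarith
  have h3 : 0 < (|C₀| / ε + 1) * Real.sqrt (-t) := by positivity
  calc Real.sqrt (-t) * ‖u t x‖ ≤ Real.sqrt (-t) * (|C₀| / (‖x‖ + Real.sqrt (-t))) :=
        mul_le_mul_of_nonneg_left h1 hs.le
    _ ≤ Real.sqrt (-t) * (|C₀| / ((|C₀| / ε + 1) * Real.sqrt (-t))) := by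
        apply mul_le_mul_of_nonneg_left _ hs.le
        exact div_le_div_of_nonneg_left (abs_nonneg _) h3 h2
    _ = |C₀| / (|C₀| / ε + 1) := by
        field_simp
    _ ≤ ε := by
        rw [div_le_iff₀ (by positivity)]
        have : |C₀| / ε * ε = |C₀| := div_mul_cancel₀ _ hε.ne'
        nlinarith [abs_nonneg C₀]

/-- **T7 ⊇ Pineau–Vicol Conj. 1.1 in the gauge**: T7 implies the decaying-profile statement
`RotatedSelfSimilarLiouvilleDecaying` of §(b) (space–time Type-I profiles, every `A ≠ 0`), whose
window `α₁ ≤ |α| ≤ α₂` is the printed open problem. So the reshape did not create an easier core. -/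
theorem rssLiouvilleOfFarField_implies_rss_decaying :
    RssLiouvilleOfFarField → RotatedSelfSimilarLiouvilleDecaying := by
  intro h C C₀ u hu hd A hA hA0 hsym t ht x
  have hcl : IsTypeIAncientMild C u := inClass_iff_isTypeIAncientMild.1 hu
  refine h C u hcl A hA hA0 ?_ (farField_of_hasTypeIDecay hd) t ht x
  intro s hs y
  simpa only [zero_add, one_smul, mul_one] using hsym s hs y

/-! ## (c) Why it resists; remarks for provers and the planner (prose record, cycle 1)

* NO JUNK ROUTE. For a smooth `u` with `‖u(t,·)‖_∞ ≤ C/√(−t)` every clause of `𝒜_C` is honest: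
  `heatFlow (u s) (t−s)` with `t − s > 0` is the Gaussian convolution of a bounded continuous field
  (`heatFlow_of_pos`, `heatExtension_apply`); the Oseen integrand obeys Koch–Tataru (14),
  `|K(τ,z)[a,b]| ≤ c(√τ+|z|)^{-4}|a||b|`, so `y ↦ K(t−τ,x−y)[u,u]` is integrable on ℝ³ and the
  `τ`-integral converges like `∫_s^t (t−τ)^{-1/2} dτ`; `timeDeriv`/`fderiv` are genuine derivatives
  on the open set `t < 0`. Hence a counterexample must be a GENUINE nonzero ancient mild
  Navier–Stokes solution with Type-I decay and a one-parameter similarity symmetry.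
* CANDIDATE FAMILIES CHECKED (all fail to lie in `𝒜_C ∩ {symmetric} ∖ {0}`): constants / parasitic
  `b(t)` (killed by the gauge resp. the decay — the two `_false_without_` lemmas are exactly these);
  Landau solutions (steady, `−1`-homogeneous, axisymmetric: singular at the origin, not Type-I in
  time); Lamb–Oseen / Burgers vortices (not ancient resp. unbounded strain); Beltrami–ABC and
  Taylor–Green cells `e^{−λt}U(x)` (exponential growth as `t → −∞`); travelling / rigidly rotating
  waves (sup-norm constant in time, incompatible with decay to `0`); steady states (ditto);
  2-D and 2.5-D fields (KNSS 2009 Thm 5.1: bounded ancient planar mild solutions are `b(t)`);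
  axisymmetric Type-I (Seregin–Šverák 2009, in tree `AxisymmetricTypeIExclusion_holds`); backward
  self-similar with bounded profile (Tsai 1998 Thm 1, `q = ∞`, in tree `tsai_selfsimilar_bounded_holds`
  — a bounded Leray profile is CONSTANT, and the constant is then killed by the gauge, Rem. 6.1).
* WHAT IS LEFT. Of the two statements of §(b), the helical one is very likely closable in-route
  (blow-down kills the pitch, see the docstring of `HelicalTypeILiouville`), and the same far-field
  recentring gives every spiral-scaling-symmetric element a profile decaying at infinity, so — modulo
  the cards' Oseen bootstrap `o(1) ⇒ K/|y|` — the residual open core of the crux is EXACTLY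
  Pineau–Vicol's Conj. 1.1 = Tsai 2018 Conj. 8.9 (Perelman): no nonzero backward rotated
  self-similar solution with Type-I (space-time) profile at rotation rate `α ~ 1`
  (`α₁(C) ≤ |α| ≤ α₂(C)`; the extreme ranges are PV Thm 1.4). That is where a counterexample to the
  crux would have to live; none is in print and the conjecture is believed. A kill here = solving
  that open problem negatively; no finite model, no decidable instance, and no certified-numerics
  route of session size (a backward RSS profile is a 3-D nonlinear elliptic eigenproblem whose
  numerical "solutions" could not be certified into `𝒜_C`). Hence: NO KILL in cycle 1.
* HYPOTHESES PROBABLY REDUNDANT (information for the prover, not proved here):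
  `IsSmoothAncient` and `IsDivFreeAncient` should follow from `IsKNSSMild` + Type-I decay
  (KNSS 2009 Prop. 4.1 regularity of bounded mild solutions; the Oseen–Duhamel term is divergence
  free and `e^{(t−s)Δ}u(s) → 0` as `s → −∞` by the decay). `IsSkew` is probably unnecessary too:
  a non-skew linear generator either has an eigenvalue with nonzero real part (then invariance +
  boundedness force the field to vanish along the expanding/contracting directions) or is nilpotent
  (shear invariance makes `u` independent of a coordinate, back to the 2.5-D case).
* SCOPE REMARK (for crux 4052 rather than this one): the generator family is `sim(3)` only; the
  Navier–Stokes symmetry algebra also has time translation `∂_t` (Galilean boosts and pressure shifts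
  are removed by the gauge). Conjugating a scaling-symmetric `u` by the admissible time shift
  `u(t,x) ↦ u(t−θ,x)`, `θ > 0` (which preserves `𝒜_C`) produces an element of `𝒜_C` whose symmetry
  generator `x·∇ + 1 + 2(t−θ)∂_t` is NOT in the family; harmless for truth (if `X` holds the class
  is `{0}`), but the "seven moduli" count of `ForcedSymmetry` silently ignores this eighth direction.

* POINTER FOR THE HELICAL SUB-CASE (unverified computation, recorded for provers): for the screw
  Killing field `B(x) = Ax + a` (`A` skew, `A a = 0`) and a `B`-symmetric solution (`(B·∇)u = Au`,
  pressure `B`-invariant — automatic for the gauge pressure `R_iR_j(u_iu_j)`), the "helical swirl"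
  `Π = ⟪u, B⟫` satisfies `(∂_t + u·∇ − Δ)Π = −2 tr(A ∇u)` (a first-order VORTICITY source: for
  `A = J₃` it is `∓2ω₃`). In the axisymmetric case `a = 0` this source equals `−(2/r)∂_rΠ`, which
  closes the equation and yields the maximum principle for `Γ = r u_θ` behind Seregin–Šverák 2009;
  whether it closes in terms of `Π` for pitch `h ≠ 0` is exactly what a Seregin–Šverák-type proof of
  `HelicalTypeILiouville` would need first. Literature: steady helical Liouville only (Han–Wang–Xie,
  Sci. China Math. 69 (2026) 737–746, doi:10.1007/s11425-024-2420-6 — paywalled, acquisition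
  acq-04694 filed); Lei–Ren–Zhang (Math. Ann. 383 (2022), arXiv:1911.01571, Thm 1) treat the
  DIFFERENT axisymmetric + `z`-periodic case (conclusion `u = c e_z`, needs `Γ` bounded).

## Cycle 2 (gen-2 seat, 2026-08-16): kernel audit, stub audit, helical leaf re-examined

* KERNEL AUDIT (no misstatement route through the gauge). The closed form of the in-tree
  `oseenKernel` was re-derived by hand from `O_{jl} = δ_{jl}G_τ − ∂_j∂_l E_τ`, `E_τ = −∫_τ^∞ G_s ds`
  (so `ΔE_τ = G_τ`): `K(τ,z)[a,b] = D_a[O(τ,·)b](z) = −(⟨z,a⟩/2τ)G_τ b + A(τ,z)(⟨z,a⟩b + ⟨a,b⟩z + ⟨z,b⟩a)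
  − B(τ,z)⟨z,a⟩⟨z,b⟩z`, `A = ∫_τ^∞ G_s/(4s²) ds`, `B = ∫_τ^∞ G_s/(8s³) ds` — it matches
  `KochTataru.oseenKernel` term by term, and `∫K(τ,x−y)[u(y),v(y)]dy = e^{τΔ}P∇·(u⊗v)(x)` with
  `(∇·(u⊗v))_l = Σ_k∂_k(u_kv_l)`. So `IsKNSSMild` is the honest Navier–Stokes Duhamel formula (up to the
  harmless global sign convention `u ↦ −u`), not a look-alike equation. Generator conventions
  re-checked: the `σ`-part is backward self-similarity about `(x,t) = (0,0)`
  (`u + 2t∂_t u + x·∇u = 0` for `u = (−t)^{-1/2}U(x/√(−t))`), the `A`-part is rotation covariance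
  `u(Rx) = Ru(x)`; `(a,σ,A) ↦ −(a,σ,A)` leaves the clause invariant, so `σ < 0` is nothing new.
* PRE-EMPTIVE STUB AUDIT of the three ideator sketches (`SketchIdeator1.lean`, `SketchIdeator2.lean`,
  `Ideator3Sketch.lean`; no line picked yet, `targets = []`):
  (i) every stub quantified over `𝒜_C` (`PastSmallnessLiouville`, `BlowdownKillsPeriod`,
  `PeriodicVanishing`, `ScrewLeaf`, `SpiralScalingDecay`, `SpiralScalingTypeIDecay`,
  `AxisymmetricFarFieldSmall`, `SwirlBarrier`, `AxisymmetricLeafOfCOverR`, `PeriodicBlowdownVanishing`,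
  `SmallAtMinusInfinityLiouville`, `FarFieldVanishing`, `AxisymmetricAxisRate`,
  `SpiralScalingSpaceTimeRate`, `AxisymmetricLeaf`, `typeI_constant_tendsto_zero_of_periodic`,
  `eq_zero_of_typeI_constant_tendsto_zero`, `decay_away_from_centre`, `decay_away_from_axis`,
  `hasTypeIDecay_of_spiral`, `rMulNorm_bounded_of_screw`, `axisymmetric_leaf`,
  `spiral_leaf_outside_window`) is UN-WITNESSABLE by §(d): a counterexample to any of them is a
  nonzero element of `𝒜_C`. They were checked instead for internal consistency — each is
  `Sim(3)`/scaling-invariant as stated, `u = 0` satisfies each, the swirl supersolution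
  `ψ_s = (C/√(−s))(r + 2C(√(−s) − √(−t)))` of `SwirlBarrier` IS a supersolution
  (`ψ_t + u_rψ_r + (2/r)ψ_r − Δψ ≥ C/(r√(−s)) ≥ 0`, using only `|u_r| ≤ C/√(−t)` and `Δr = 1/r`) but the
  comparison on `ℝ³` needs a Phragmén–Lindelöf step since `Γ − ψ_s` may grow linearly at spatial
  infinity for `t > s` (bounded drift on `[s,t]`: fine, but it must be written) — no defect found.
  (ii) UNIFORMITY GAP (a note for the lead, not a refutation): `decay_away_from_centre`,
  `hasTypeIDecay_of_spiral`, `FarFieldVanishing`, `SpiralScalingSpaceTimeRate` promise constants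
  uniform over ALL skew `A` at fixed `C`. The sketched compactness proof ("divide the generator by
  `N_n = |(1+A_n)x_n| → ∞`; the limit is translation invariant, hence `0` by leaf (T)") does NOT give
  this when `‖A_n‖/N_n ↛ 0` — e.g. `x_n` on the axis of `A_n` with `‖A_n‖ ≳ |x_n|`: the normalised
  generators then converge to a ROTATION (plus translation) generator and the limit is a nonzero
  axisymmetric/helical element of `𝒜_C`, excluded only by the rotation leaves, not by leaf (T). Either
  let `ρ, K` depend on `‖A‖` too (enough for the crux, where `A` is fixed per `u`; by scaling only the
  dimensionless combination matters) or route that case through the axis leaves explicitly.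
  (iii) Stubs NOT over `𝒜_C`, hence falsifiable in principle — all survive: `HelicalIsPeriodic` and
  `periodic_of_screw` (the flow of `h e_z + Jx` is the rotation by angle `s` about `e_z` composed with
  the translation `s h e_z`, the clause integrates to `u(Φ_s x) = e^{sJ}u(x)`, and `e^{2πJ} = 1` on
  `ℝ³`, so `u(x + 2πh e_z) = u(x)` — true, now KERNEL-CHECKED as `screw_equivariant` /
  `periodic_of_screw_clause` / `isAxisymmetric_of_clause`, §(f); `h ≠ 0` is not even needed); `SpiralWeightIdentity` (its
  hypotheses contain the full RSS profile system with decay (1.9): the only inhabitant in print is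
  `U = 0`, `P = const`, `w = e^{−|y|²/4}` — which does solve `Δw + (½y − αJy)·∇w + (3/2)w = 0` since
  `Jy ⊥ ∇w` — where it reads `0 = 0`); `SpiralWeightEnstrophyCeiling` (Cauchy–Schwarz; the
  un-assumed integrability of `Ω₂w = (Ω₂√w)(√w)` follows from that of `|Ω|²w` and `w`, and were it to
  fail, the Bochner junk value `0` would make hypothesis and conclusion trivial);
  `symmetricLiouville_of_normal_forms` (conjugation: `𝒜_C` is translation invariant, the clause is
  linear in `ξ`, `σ·1 + A` is invertible for `σ ≠ 0` and `A` skew since `⟨(σ+A)x,x⟩ = σ|x|²`, and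
  `a_⊥ ∈ range A = (ker A)^⊥` moves the axis — provable).
* HELICAL LEAF RE-EXAMINED ADVERSARIALLY. The blow-down argument recorded in the docstring of
  `HelicalTypeILiouville` was rechecked step by step: period `L = (2π/|ω|)a` from `e^{2πA/|ω|} = 1`;
  blow-downs `λu(λ²t,λx)` stay in `𝒜_C` with period `L/λ → 0`; local `C¹` compactness (KNSS §4
  bounds on `(−∞,−δ)`) + dominated convergence in the Oseen identity (integrable majorant
  `(C²/(−τ))·c(√(t−τ)+|z|)^{-4}`) keep limits in `𝒜_C`; a limit with a dense set of periods is
  constant along the axis; leaf (T) (`KNSS2009_typeI_rate_liouville`) wants a BOUNDED field, so it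
  must be applied to the time-shifted limit `U(·−δ)` (`IsTypeIAncientMild.comp_sub_right`), for every
  `δ > 0`; this gives `ε(t) := √(−t)‖u(t)‖_∞ → 0` as `t → −∞` (the region `r ≤ R√(−t)`, `|z| ≤ L` is
  covered by blow-down limits, the region `r ≥ R√(−t)` by far-field recentring, uniformly after
  rescaling to `t = −1`); finally the gap inequality of `exists_eps_small_vanishes` run on `(−∞,T]`
  (`B(T) ≤ B(T)/2 + K₀B(T)²` involves only times `< T`) gives `u = 0` on `(−∞,T]` for `T ≪ 0`, and
  `oseenMild_bounded_unique` propagates `0` forward. No gap found: the helical leaf is not where a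
  counterexample can live. (Consistent with the classical fact that helically symmetric
  Navier–Stokes flows are essentially two-dimensional and globally regular in the setting of
  Mahalov–Titi–Leibovich, *Invariant helical subspaces for the Navier–Stokes equations*, Arch.
  Ration. Mech. Anal. 112 (1990) — so no helical element of `𝒜_C` arises as a blow-up limit of such
  flows either; a search for whole-space/large-data variants is part of the deferred refresh.)
* RESIDUAL CORE UNCHANGED: `RotatedSelfSimilarLiouvilleDecaying` at `α₁(C) ≤ |α| ≤ α₂(C)` =
  Pineau–Vicol Conj. 1.1 = Tsai 2018 Conj. 8.9 in the gauge class. By `exists_eps_vanishes_of_le` the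
  window is also empty for `C ≤ ε₀` (every `α`). THE PRINTED OBSTRUCTION (arXiv:2607.09619, read
  2026-08-16): p. 4, "Why is Conjecture 1.1 open for α ≠ 0? Assumption (1.9) only implies that the
  profile U belongs to the weak-L³ class … Had we assumed … U ∈ L³ … [ESS] would imply regularity
  … The genuine difficulty therefore lies in the borderline decay rate (1.9) … When α ≠ 0 … the
  antisymmetric rotation terms α(JU − (Jy·∇)U) … destroy [the head-pressure maximum principle]. We
  are not aware … of any scalar quantity (an α-dependent modification of (1.4)) playing the role of
  the Bernoulli function … This is the central obstruction"; p. 4, Thm 1.4 "resolves Conjecture 1.1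
  for |α| ≪ 1 and |α| ≫ 1, but leaves open the case α ≈ 1"; p. 7, Rem. 1.8 (Šverák): the solitons of
  Navier–Stokes with bounded velocity and decaying pressure are, up to Galilean conjugation, steady
  states, rotating waves `R(ωt)U(R(−ωt)x)`, backward RSS solutions (1.7) and their forward analogues —
  "RSS solutions are the general scaling solitons … Backward solitons are conjecturally trivial". In
  the crux's class the time-periodic solitons (steady states, rotating/travelling waves) are killed by
  the Type-I decay (`‖u(t)‖_∞` constant in time and `≤ C/√(−t) → 0`), the spatial-isometry-invariant
  ones by leaves (T)/(R₀)/(helical), so the surviving soliton type is exactly the backward RSS one: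
  the crux's residual IS the printed conjecture, no more and no less (modulo the profile-decay
  upgrade o(1) ⇒ (1.9) of the cards). LITERATURE REFRESH 2026-08-16 (Semantic Scholar;
  searchd down, OpenAlex/arXiv rate-limited, galaxy substring probes empty): the queries "Liouville
  theorem helical Navier–Stokes" and "rotated self-similar solutions Navier–Stokes blow-up Liouville"
  return, besides older self-similar/DSS exclusions (Chae–Wolf, ARMA 2017 = arXiv:1609.06962 and
  CPDE 2017 = arXiv:1610.09464; Hou–Li, DCDS 18 (2007)), only the STEADY helical Liouville theorems of
  Han–Wang–Xie (Sci. China Math. 2025, doi:10.1007/s11425-024-2420-6; arXiv:2312.10382) and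
  Pineau–Vicol (arXiv:2607.09619) — no Liouville theorem for time-dependent/ancient helical solutions,
  no result in PV's middle range, and no construction or numerical candidate of a nonzero symmetric
  Type-I ancient solution (Hou's 2026 "nearly self-similar blowup" is for GENERALISED axisymmetric
  models, doi:10.1007/s10208-026-09748-8, not for Navier–Stokes). `lit frontier` (30 newest
  descendants of the summit's roots) likewise shows nothing on symmetric ancient solutions.

-- Targets (cycle 3): line `blowdown-kills-pitch` PICKED (PICKED.md 2026-08-16T03:44Z); registered stubs
-- stub_screwIsPeriodic / stub_rotationCovariance / stub_periodicBlowdownVanishing /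
-- stub_smallAtMinusInfinityLiouville / stub_selfSimilarLeaf / stub_rotatedSelfSimilarLiouville — see §(g):
-- 0 broken; T1/T2′/T3/T4/T5a/T6 are TREE THEOREMS (Theorems/SymmetryModuliCountSymmetricLiouville*.lean, 05:07–05:23Z)
-- and independently proved in this seat's folder (candidate proofs attached; HelicalEndLiouville by name);
-- reshape e35ce922ec1c: T7 stub_rssLiouvilleOfFarField = the OPEN CORE (decaying-profile RSS Liouville ⊇ PV Conj 1.1),
-- so crux ≡ AxisymEndLiouville (stmt-14061) ∧ T7 by the lead's SymmetricLiouville_of; payload.stuck_stubs = [].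
-/

end Summit.NavierStokesRegularity.NavierStokesRegularity.Cruxes.SymmetricLiouville.Disproof

end
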